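import Literature.MathematicalPhysics.QuantumFieldTheory.Balaban1983to89.Beta.Assembly
import Literature.MathematicalPhysics.QuantumFieldTheory.Balaban1983to89.Beta.Certified
import Literature.MathematicalPhysics.QuantumFieldTheory.Balaban1983to89.Beta.MomentSymbol

/-!
# `Balaban1983to89.Beta.RateCertificate` — the interface between the ASYMPTOTIC lane (a rate for the one-loop
coefficients) and the CERTIFIED lane (finitely many certified finite-k values): the limit CONSTRUCTED from a one-step
(Cauchy) rate, the SIGN of the limit and the positivity tail from ONE certified value, and Theorem 2 as printed from
rate + certificates alone (β sub-cell of the audit cell `pub-balaban`, asymptotic lane asym1)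

HONEST FRAMING (cell rule, verbatim, page 1 of everything the β sub-cell writes): discharging `BetaPertH` makes
Bałaban's UV stability UNCONDITIONAL — a real constructive-QFT result; it is NOT the continuum limit and NOT the Clay
problem.  THIS MODULE DISCHARGES NOTHING of the series: it is `[folklore]` real analysis about an arbitrary sequence
`b : ℕ → ℝ` (standing for the one-loop parts `β⁰_{k+1}` of the β-functions (1.22) of [Balaban1987RG1]) and a repackaging
of the cell's `Beta.Assembly.LimitForm`.  Every analytic input is a HYPOTHESIS; nothing printed by Bałaban is asserted.
Value = kernel-checked bookkeeping for the β sub-cell's roads, NOT summit progress.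

CITATION HEADER (lean-in-tree rule 2026-08-18).  T. Bałaban, *Renormalization group approach to lattice gauge field
theories. I. Generation of effective actions in a small field approximation and a coupling constant renormalization in
four dimensions*, Commun. Math. Phys. **109**, 249–301 (1987) [Balaban1987RG1] (cell paper B12; PDF held:
`paper:balaban1987-cmp109-rg-i-small-field`): p. 259 Theorem 2 with (0.31) (the consumer, typed `B12.Thm2Printed`);
p. 264 (1.22) (the one-loop coefficient `β_{j+1}(g_j) = Σ_x Π_{j+1,μν}(g_j,x) x_μ x_ν`, typed `B12Beta.secondMoment`);
p. 268 (2.12)–(2.14) (the one-loop split, typed `B12Beta.OneLoopSplit`).  The cell located (HOME/BETA-SPEC.md §0.3,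
HOME/BETA/WALL.md v1.4 §7, GAPS G-an2-2 (c)) that NO `η = L^{−k} → 0` convergence statement for these coefficients —
with or without rate — is printed in the series; the rate is the asymptotic lane's located OPEN input and enters below
only as the hypothesis shapes `GeomRate` / `CauchyRate`.

WHAT THIS MODULE ADDS to `Beta.Assembly` / `Beta.LimitRate` (which already reduce "inf_k β⁰_{k+1} > 0" to the finite
list (AF-0s) GIVEN a `LimitForm`, whose field `binf_pos : 0 < β⁰_∞` is there an INPUT — supplied either by row an3's
transfer statement `TransferBal` (`LimitRate.limit_pos_of_transfer`) or by a uniform (AF-0) (`binf_pos_of_uniformAF0`)):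
* §1 `GeomRate b binf c₀ θ` (`|b_k − b_∞| ≤ c₀θ^k`, the (AF-0r) shape) and `CauchyRate b c θ`
  (`|b_{k+1} − b_k| ≤ cθ^k`, the shape a scale-by-scale comparison of the level-`k` and level-`(k+1)` one-loop data
  delivers, cf. `LimitRate.StepRate` for kernels); `CauchyRate.geomRate`: the limit `CauchyRate.lim b` is CONSTRUCTED
  and `|b_k − lim b| ≤ (c/(1−θ))θ^k` (real-sequence twin of `LimitRate.StepRate.geometricRate`; Mathlib
  `cauchySeq_of_le_geometric`, `dist_le_of_le_geometric_of_tendsto`).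
* §2 THE SIGN OF THE LIMIT FROM ONE CERTIFIED VALUE: `GeomRate.binf_ge` / `binf_le` (the enclosure
  `m − c₀θ^{k₁} ≤ b_∞ ≤ M + c₀θ^{k₁}` from a certified enclosure `m ≤ b_{k₁} ≤ M`), `GeomRate.binf_pos`
  (`c₀θ^{k₁} < m ⇒ 0 < b_∞`), the tail `GeomRate.tail_ge` (`k ≥ k₁ ⇒ b_k ≥ m − 2c₀θ^{k₁}`), `GeomRate.tail_pos` and
  `GeomRate.pos_all` (the coordinator's `betaBar_pos_of_ge k₀` and "positivity for all k from the bound + the certified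
  values `k ≤ k₀`") — with NO identification of the limit (`b_∞ = stepBal N L`, the wall's binder (D1) of WALL.md §4)
  and no transfer statement: for the SIGN, one certified finite-k value replaces the identification.
* §3 `limitFormOfCertified`: a `LimitForm` from the split, a `GeomRate` about a `binf` of UNKNOWN sign, ONE certificate
  and the remaining clauses; `thm2Printed_of_certified` / `thm2Printed_of_cauchyCertified`: Theorem 2 as printed from
  (rate) + (one certified enclosure at `k₁`) + (the certified list `3B⁺/4 ≤ β⁰_{k+1}, k < k₂`) + (AF-1), (C), (U) and the
  DAG, every threshold explicit in `m, M, c₀, θ` — the END statement of the cap × asym split.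
* §5 (v1.1) THE INTERLOCK with the certified lane's carrier `Beta.Certified.SmallKCert` (cap3): `GeomRate.smallKCert`
  builds a `SmallKCert b binf` from the rate, ONE certified rational upper value `b k₁ ≤ M`, a rational `q ≥ c₀θ^{k₁}` and a
  certified list with thresholds against `bhi := M + q` (the field `binf_le` DISCHARGED by `GeomRate.binf_le`);
  `thm2Printed_of_smallKCert`: Theorem 2 as printed by `Certified.thm2Printed_of_cert` over `limitFormOfCertified`, its
  rate hypothesis `c₀θ^{k₁} ≤ β⁰_∞/4` DISCHARGED by `GeomRate.binf_ge` + an index test against the certified lower value.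
* §6 (v1.2) THE SYMBOL SOCKET with `Beta.MomentSymbol` (p184097): `SymbolStepRate P μ ν c θ` (OPEN hypothesis
  shape: per scale, the three zero-momentum curvatures of the directional symbols of the `(μ,ν)` component move by
  `≤ c·θ^k`) is a `CauchyRate` with constant `(3/2)·c` for any `b` identified with the second moments (1.22)
  (`SymbolStepRate.cauchyRate`, via `MomentSymbol.cauchyRate_secondMoment`); END statements
  `thm2Printed_of_symbolCertified` / `thm2Printed_of_symbolSmallKCert` / `beta0_pos_all_of_symbolSmallKCert` /
  `beta0_tail_pos_of_symbolRate` = §3/§5 with the rate constant read in MOMENTUM space (ASYM-beta.md R-asym1-2: no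
  position-space decay constant enters).
* §7 (v1.3) THE MARGIN FORM — the cheapest cap × asym interlock: from `GeomRate S.β0 binf c₀ θ` (`0 ≤ θ ≤ 1`, `binf`
  ANY real, never identified) and ONE-SIDED certified lower values `m ≤ β⁰_{k+1}` for `k ≤ k₁`, every one-loop
  coefficient is `≥ m − c₀θ^{k₁}(1+θ)` (`GeomRate.lower_of_list`); the single gap inequality `c₀θ^{k₁}(1+θ) < m`
  (budget `c₀ < m·θ^{−k₁}/(1+θ)`) then gives `B12.Thm2Printed C L` with NO enclosure, NO index test and NO threshold
  list (`eventualFormOfMargin` = `Assembly.EventualForm.ofSplitOneSided` with `k₀ := 0`; `thm2Printed_of_margin` /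
  `_of_cauchyMargin` / `_of_symbolMargin`, `beta0_pos_all_of_margin`, `betaAFH_of_margin`, `endpointExistence_of_margin`).
* §4 the identification AS A COROLLARY when it is wanted: `CauchyRate` + the drift form `Drift.OneLoopDrift s A b`
  (road (1) of the sub-cell) force `lim b = s` (`Transfer.limit_eq_of_marginalBounded`, Cesàro); non-vacuity witnesses.
* §8 (v1.4) THE STRIP SOCKET (momentum route (S2) of R-asym1-2, with `Beta.MomentSymbol` v1.1 §5): `StripStepRate P μ ν R c θ`
  (OPEN hypothesis SHAPE: on the circle `‖z‖ = R` the complexified directional symbols of the `(μ,ν)` components of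
  consecutive kernels differ by `≤ c·θ^k`, three directions) ⇒ `SymbolStepRate P μ ν (2c/R²) θ` by CAUCHY'S ESTIMATE
  (`StripStepRate.symbolStepRate`, needs the exponential moments `ExpMoment (P k μ ν) v R`, supplied from (5.10) by
  `expMoments_of_decay510` for every `R < δ₁`, `μ ≠ ν`) ⇒ `CauchyRate S.β0 (3c/R²) θ` (`StripStepRate.cauchyRate`) ⇒
  `thm2Printed_of_stripMargin` / `beta0_pos_all_of_stripMargin` (margin form §7 with `c₀ = 3c/(R²(1−θ))`): the constant
  that enters the cap budget carries NO position-space factor `Σ_x |x|²e^{−δ|x|}`.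
* §9 (v1.5) THE REAL-ZONE SOCKET (three-lines upgrade of §8, with `Beta.MomentSymbol` v1.2 §6): `RealStepRate P μ ν c θ`
  (OPEN hypothesis SHAPE: along the three directions and for every REAL `t` the directional symbols of consecutive
  kernels differ by `≤ c·θ^k` — a statement on the real Brillouin zone, the shape of King 1986 Prop. 3.10 / Lemma 4.4)
  + `StripBound P μ ν R M` (k-uniform bound on the strip `|Im z| ≤ R`; FREE from (5.10): `stripBound_of_decay510` with
  `M = C·Σ_x e^{−(δ₁−R)|x|₁}`) ⇒ `StripStepRate P μ ν r (c^{1−r/R}(2M)^{r/R}) (θ^{1−r/R})` on every circle `r ≤ R`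
  (`RealStepRate.stripStepRate`, Hadamard three lines) ⇒ `thm2Printed_of_realMargin` / `beta0_pos_all_of_realMargin`
  / `beta0_pos_all_of_realMargin_decay` (cap budget: `c₀ = 3c'/(r²(1−θ'))`, `c' = c^{1−r/R}(2M)^{r/R}`, `θ' = θ^{1−r/R}`;
  at `r = R/2`: `c₀ = 12√(2Mc)/(R²(1−√θ))`).  Suppliers need NO complex momenta.
* §10 (v1.6) BLOCK TRANSFER (sequence algebra only): `blockSum n b k = Σ_{i<n} b (n k + i)`; `cauchyRate_blockSum :
  CauchyRate b c θ → CauchyRate (blockSum n b) (c·(Σ_{i<n} θ^i)²) (θ^n)` and `geomRate_blockSum : GeomRate b b_∞ c₀ θ →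
  GeomRate (blockSum n b) (n·b_∞) (c₀·Σ_{i<n} θ^i) (θ^n)`; END `thm2Printed_of_blockMargin` / `beta0_pos_all_of_blockMargin`: IF (hypothesis `hblock` —
  the located one-loop COMPOSITION QUESTION Q-asym1-5, journal l.47635; a question, NOT a printed fact, NOT asserted
  here) the one-loop coefficients of a construction with block size `L^n` are the block sums of those at block size `L`,
  then a small-`L` step rate and small-`L` one-sided certified lower values (`k ≤ k₁` block sums) give Theorem 2 as
  printed for that construction (e.g. `L = 3 ↦ 27`).  CAVEAT (v1.6.1, memo §4″): WHICH block-size-`L^n` scheme `hblock` can hold for —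
  the re-indexed `L`-chain, the one-shot step with the COMPOSED average, or a genuine single B12 step with the average
  (0.4)/(0.12) at block size `L^n` (the only one literally inside the printed regime «L odd > 11», B12 p.251) — is part
  of the question Q-asym1-5; for the genuine step `hblock` holds iff Q-asym1-5 (iii) does, else only a scheme-transfer RATE (§11).
* §11 (v1.7) NEAR-SEQUENCE TRANSFER (sequence algebra only; the inequality form of `hblock`): `NearRate a b e ϑ :=
  ∀ k, |b k − a k| ≤ e·ϑ^k`; a `GeomRate`/`CauchyRate` of a comparison sequence `a` and a one-sided list `m ≤ a k (k ≤ k₁)`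
  transfer to `b` at the cost `c₀ ↦ c₀ + e` (`c ↦ c + e(1+ϑ)`), `m ↦ m − e` (`NearRate.geomRate/.cauchyRate/.list`); END
  `thm2Printed_of_nearMargin` / `beta0_pos_all_of_nearMargin` (any comparison sequence) and `thm2Printed_of_blockNearMargin` /
  `beta0_pos_all_of_blockNearMargin` (comparison = block sums of a small-block sequence, ratio `θ^n`): Theorem 2 as printed
  for the GENUINE block-size-`L^n` step from small-block rate + small-block certified list + the located one-loop
  scheme-transfer nearness `NearRate (blockSum n b) S.β0 e (θ^n)` (OPEN, never asserted; `e = 0` is §10's `hblock`,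
  `beta0_pos_all_of_blockMargin'`).
* §12 (v1.8) EVENTUAL RATES — the first-step exemption (sequence algebra only): `EvGeomRate b b_∞ c₀ θ k₁` /
  `EvCauchyRate b c θ k₁` / `EvSymbolStepRate P μ ν c θ k₁` (the §1/§6 shapes for the scales `k ≥ k₁` ONLY); an eventual
  rate from `k₁` is a §1 rate for the shifted sequence `j ↦ b_{j+k₁}` with constant `c₀θ^{k₁}` (`EvGeomRate.shift`,
  `EvCauchyRate.shift`, `EvCauchyRate.evGeomRate`), so the margin form needs the rate only where no certified value is
  available: `EvGeomRate.lower_of_list` (SAME margin `m − c₀θ^{k₁}(1+θ)` as §7, `c₀` now the TAIL constant),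
  `eventualFormOfFloor` / `thm2Printed_of_floor` (the §7 construction from an abstract uniform floor `0 < b₀ ≤ β⁰_{k+1}`),
  END `thm2Printed_of_evMargin` / `_of_evCauchyMargin` / `_of_evSymbolMargin`, `beta0_pos_all_of_evMargin`,
  `betaAFH_of_evMargin`, `endpointExistence_of_evMargin`; `Witness.evMargin_gain` (a first-step anomaly for which every
  ∀k rate fails the `k₁ = 1` gap and the eventual rate passes it).  Cap × asym protocol it serves (memo §4‴ v3): the
  certified lane certifies EVERY depth `k ≤ k₁` (`k₁ = 1`), the asymptotic lane owes the rate for `k ≥ k₁` only.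

PROVENANCE (v1.8.1, DOCSTRING-ONLY; v1.8 = p185751): the §9 reading note cited King's Prop. 3.10 / Lemma 4.4 under volume
«CMP 103» — that is Part II (*The U(1) Higgs model. II*, CMP 103 (1986) 323–349 [King1986InfiniteVolume]); the displays
are Part I, CMP 102 (1986) 649–677 [King1986] (held text, running heads pp. 669/673); corrected, declarations byte-identical
(cell ERRATUM E-asym1g10-2).

WHAT THIS MODULE IS NOT.  It proves no rate, no certificate and no clause for Bałaban's family; it does not touch
`Beta.Assembly`, `Beta.LimitRate`, `Beta.Certified`, `FlowStepRuns` (used BY NAME).  Cell records: HOME/BETA/ASYM-beta.md (asymptotic lane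
memo: the inequality chain behind `GeomRate`/`CauchyRate` for (1.22), every constant sourced or labelled OPEN, and the
k₀ protocol with the certified lanes cap1–3), journal node BETA-asym1-RATE-CERTIFICATE (unit `b2b-balaban-beta-asym1`).
-/

namespace Literature.MathematicalPhysics.QuantumFieldTheory.Balaban1983to89.Beta.RateCertificate

open Literature.MathematicalPhysics.QuantumFieldTheory.Balaban1983to89
open FlowStep FlowStepRuns DagBinding Filter
open scoped _root_.Topology

noncomputable section

/-! ## 1. The two rate shapes for a real sequence; the limit constructed from the Cauchy shape -/

/-- HYPOTHESIS SHAPE (AF-0r): `|b_k − b_∞| ≤ c₀·θ^k` for all `k` — the field `conv` of `Beta.Assembly.LimitForm` for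
`b = S.β0`.  Located, NOT printed, for the coefficients (1.22). [cite: Balaban1987RG1, (1.22) p.264] -/
def GeomRate (b : ℕ → ℝ) (binf c₀ θ : ℝ) : Prop :=
  ∀ k, |b k - binf| ≤ c₀ * θ ^ k

/-- HYPOTHESIS SHAPE (AF-0r, Cauchy form): `|b_{k+1} − b_k| ≤ c·θ^k` for all `k` — what a comparison of the
scale-`(k+1)` and scale-`k` one-loop data (depth `η = L^{−(k+1)}` versus `L^{−k}` below the unit lattice) delivers; no
limit value is named.  Located, NOT printed, for (1.22). [cite: Balaban1987RG1, (1.22) p.264] -/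
def CauchyRate (b : ℕ → ℝ) (c θ : ℝ) : Prop :=
  ∀ k, |b (k + 1) - b k| ≤ c * θ ^ k

namespace GeomRate

variable {b : ℕ → ℝ} {binf c₀ θ : ℝ}

/-- The constant of a `GeomRate` is `≥ 0` (take `k = 0`). [folklore] -/
theorem const_nonneg (h : GeomRate b binf c₀ θ) : 0 ≤ c₀ := by
  simpa using (abs_nonneg _).trans (h 0)

/-- `GeomRate` with `0 ≤ θ < 1` gives convergence `b_k → b_∞`. [folklore] -/
theorem tendsto (h : GeomRate b binf c₀ θ) (hθ0 : 0 ≤ θ) (hθ1 : θ < 1) : Tendsto b atTop (𝓝 binf) :=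
  LimitRate.tendsto_of_abs_sub_le_geometric hθ0 hθ1 h

/-- … hence the limit value of a `GeomRate` is unique. [folklore] -/
theorem binf_unique (h : GeomRate b binf c₀ θ) {binf' c₀' θ' : ℝ} (h' : GeomRate b binf' c₀' θ') (hθ0 : 0 ≤ θ)
    (hθ1 : θ < 1) (hθ0' : 0 ≤ θ') (hθ1' : θ' < 1) : binf = binf' :=
  tendsto_nhds_unique (h.tendsto hθ0 hθ1) (h'.tendsto hθ0' hθ1')

/-- A two-ended rate is a one-step rate with constant `2c₀` (for `0 ≤ θ ≤ 1`). [folklore] -/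
theorem cauchyRate (h : GeomRate b binf c₀ θ) (hθ0 : 0 ≤ θ) (hθ1 : θ ≤ 1) : CauchyRate b (2 * c₀) θ := by
  intro k
  have h1 := h (k + 1)
  have h2 := h k
  have hθk : θ ^ (k + 1) ≤ θ ^ k := pow_le_pow_of_le_one hθ0 hθ1 (Nat.le_succ k)
  have hc := h.const_nonneg
  have e : b (k + 1) - b k = (b (k + 1) - binf) - (b k - binf) := by ring
  rw [e]
  calc |(b (k + 1) - binf) - (b k - binf)| ≤ |b (k + 1) - binf| + |b k - binf| := abs_sub _ _
    _ ≤ c₀ * θ ^ (k + 1) + c₀ * θ ^ k := add_le_add h1 h2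
    _ ≤ c₀ * θ ^ k + c₀ * θ ^ k := by linarith [mul_le_mul_of_nonneg_left hθk hc]
    _ = 2 * c₀ * θ ^ k := by ring

/-- Weakening the constants of a `GeomRate`. [folklore] -/
theorem mono (h : GeomRate b binf c₀ θ) {c₀' θ' : ℝ} (hc : c₀ ≤ c₀') (hθ0 : 0 ≤ θ) (hθ : θ ≤ θ') :
    GeomRate b binf c₀' θ' := fun k =>
  (h k).trans (mul_le_mul hc (pow_le_pow_left₀ hθ0 hθ k) (pow_nonneg hθ0 k) (h.const_nonneg.trans hc))

end GeomRate

namespace CauchyRate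

variable {b : ℕ → ℝ} {c θ : ℝ}

/-- The constant of a `CauchyRate` is `≥ 0` (take `k = 0`). [folklore] -/
theorem const_nonneg (h : CauchyRate b c θ) : 0 ≤ c := by
  simpa using (abs_nonneg _).trans (h 0)

/-- `CauchyRate` in Mathlib's `dist` form. [folklore] -/
theorem dist_le (h : CauchyRate b c θ) (k : ℕ) : dist (b k) (b (k + 1)) ≤ c * θ ^ k := by
  rw [Real.dist_eq, abs_sub_comm]; exact h k

/-- A `CauchyRate` with `θ < 1` makes `b` a Cauchy sequence. [folklore] -/
theorem cauchySeq (h : CauchyRate b c θ) (hθ1 : θ < 1) : CauchySeq b :=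
  cauchySeq_of_le_geometric θ c hθ1 h.dist_le

/-- … hence convergent (completeness of `ℝ`). [folklore] -/
theorem exists_tendsto (h : CauchyRate b c θ) (hθ1 : θ < 1) : ∃ a : ℝ, Tendsto b atTop (𝓝 a) :=
  cauchySeq_tendsto_of_complete (h.cauchySeq hθ1)

/-- THE CONSTRUCTED LIMIT `b_∞ := lim_{k→∞} b_k` (a definite real number for every sequence; it is the limit whenever
one exists). [folklore] -/
def lim (b : ℕ → ℝ) : ℝ := limUnder atTop b

/-- Under a `CauchyRate` with `θ < 1`, `b_k → lim b`. [folklore] -/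
theorem tendsto_lim (h : CauchyRate b c θ) (hθ1 : θ < 1) : Tendsto b atTop (𝓝 (lim b)) :=
  tendsto_nhds_limUnder (h.exists_tendsto hθ1)

/-- Any limit of `b` IS `lim b`. [folklore] -/
theorem eq_lim (h : CauchyRate b c θ) (hθ1 : θ < 1) {a : ℝ} (ha : Tendsto b atTop (𝓝 a)) : a = lim b :=
  tendsto_nhds_unique ha (h.tendsto_lim hθ1)

/-- **Cauchy rate ⇒ two-ended rate about the constructed limit, constant `c/(1−θ)`**:
`|b_k − lim b| ≤ (c/(1−θ))·θ^k`.  (Real-sequence twin of `LimitRate.StepRate.geometricRate`.) [folklore] -/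
theorem geomRate (h : CauchyRate b c θ) (hθ1 : θ < 1) : GeomRate b (lim b) (c / (1 - θ)) θ := by
  intro k
  have := dist_le_of_le_geometric_of_tendsto θ c hθ1 h.dist_le (h.tendsto_lim hθ1) k
  rw [Real.dist_eq] at this
  calc |b k - lim b| ≤ c * θ ^ k / (1 - θ) := this
    _ = c / (1 - θ) * θ ^ k := by ring

/-- The two-ended rate about ANY known limit value `a` of `b`. [folklore] -/
theorem geomRate_of_tendsto (h : CauchyRate b c θ) (hθ1 : θ < 1) {a : ℝ} (ha : Tendsto b atTop (𝓝 a)) :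
    GeomRate b a (c / (1 - θ)) θ := by
  rw [h.eq_lim hθ1 ha]; exact h.geomRate hθ1

end CauchyRate

/-! ## 2. The sign of the limit and the positivity tail from ONE certified value (no identification of the limit) -/

namespace GeomRate

variable {b : ℕ → ℝ} {binf c₀ θ : ℝ}

/-- **Lower enclosure of the limit from one certified lower bound**: `m ≤ b_{k₁}` ⇒ `m − c₀θ^{k₁} ≤ b_∞`. [folklore] -/
theorem binf_ge (h : GeomRate b binf c₀ θ) {k₁ : ℕ} {m : ℝ} (hm : m ≤ b k₁) : m - c₀ * θ ^ k₁ ≤ binf := by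
  have := (abs_le.mp (h k₁)).2
  linarith

/-- **Upper enclosure of the limit from one certified upper bound**: `b_{k₁} ≤ M` ⇒ `b_∞ ≤ M + c₀θ^{k₁}`. [folklore] -/
theorem binf_le (h : GeomRate b binf c₀ θ) {k₁ : ℕ} {M : ℝ} (hM : b k₁ ≤ M) : binf ≤ M + c₀ * θ ^ k₁ := by
  have := (abs_le.mp (h k₁)).1
  linarith

/-- **THE SIGN OF THE LIMIT FROM ONE CERTIFICATE**: if `m ≤ b_{k₁}` is certified at an index where the rate's slack is
already below it, `c₀θ^{k₁} < m`, then `0 < b_∞` — no identification `b_∞ = stepBal N L`, no transfer statement.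
[folklore] -/
theorem binf_pos (h : GeomRate b binf c₀ θ) {k₁ : ℕ} {m : ℝ} (hm : m ≤ b k₁) (hgap : c₀ * θ ^ k₁ < m) :
    0 < binf := by
  have := h.binf_ge hm
  linarith

/-- **The tail from one certificate**: for `0 ≤ θ ≤ 1`, `m ≤ b_{k₁}` and every `k ≥ k₁`,
`b_k ≥ m − c₀θ^{k₁} − c₀θ^k ≥ m − 2c₀θ^{k₁}`. [folklore] -/
theorem tail_ge (h : GeomRate b binf c₀ θ) (hθ0 : 0 ≤ θ) (hθ1 : θ ≤ 1) {k₁ : ℕ} {m : ℝ} (hm : m ≤ b k₁) {k : ℕ}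
    (hk : k₁ ≤ k) : m - 2 * (c₀ * θ ^ k₁) ≤ b k := by
  have h1 := h.binf_ge hm
  have h2 := (abs_le.mp (h k)).1
  have hθk : θ ^ k ≤ θ ^ k₁ := pow_le_pow_of_le_one hθ0 hθ1 hk
  have h3 := mul_le_mul_of_nonneg_left hθk h.const_nonneg
  linarith

/-- **`betaBar_pos_of_ge k₁` from the rate bound + ONE certified value**: `m ≤ b_{k₁}` with `2c₀θ^{k₁} < m` ⇒
`0 < b_k` for every `k ≥ k₁`. [folklore] -/
theorem tail_pos (h : GeomRate b binf c₀ θ) (hθ0 : 0 ≤ θ) (hθ1 : θ ≤ 1) {k₁ : ℕ} {m : ℝ} (hm : m ≤ b k₁)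
    (hgap : 2 * (c₀ * θ ^ k₁) < m) {k : ℕ} (hk : k₁ ≤ k) : 0 < b k := by
  have := h.tail_ge hθ0 hθ1 hm hk
  linarith

/-- **Positivity for ALL k from the bound + the certified values `k ≤ k₁`**: the certified signs `0 < b_k, k < k₁`,
one certified lower bound `m ≤ b_{k₁}` with `2c₀θ^{k₁} < m`, and the rate. [folklore] -/
theorem pos_all (h : GeomRate b binf c₀ θ) (hθ0 : 0 ≤ θ) (hθ1 : θ ≤ 1) {k₁ : ℕ} {m : ℝ}
    (hlist : ∀ k, k < k₁ → 0 < b k) (hm : m ≤ b k₁) (hgap : 2 * (c₀ * θ ^ k₁) < m) : ∀ k, 0 < b k :=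
  fun k => (lt_or_ge k k₁).elim (hlist k) (fun hk => h.tail_pos hθ0 hθ1 hm hgap hk)

/-- A UNIFORM positive lower bound for all `k` from the same data: `min (m − 2c₀θ^{k₁}) m₀ ≤ b_k` when `m₀ ≤ b_k` is
certified for `k < k₁`. [folklore] -/
theorem lower_all (h : GeomRate b binf c₀ θ) (hθ0 : 0 ≤ θ) (hθ1 : θ ≤ 1) {k₁ : ℕ} {m m₀ : ℝ}
    (hlist : ∀ k, k < k₁ → m₀ ≤ b k) (hm : m ≤ b k₁) :
    ∀ k, min (m - 2 * (c₀ * θ ^ k₁)) m₀ ≤ b k :=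
  fun k => (lt_or_ge k k₁).elim (fun hk => (min_le_right _ _).trans (hlist k hk))
    (fun hk => (min_le_left _ _).trans (h.tail_ge hθ0 hθ1 hm hk))

end GeomRate

/-- **The (AF-0s)-type list threshold served by an enclosure**: if `b_∞ ≤ B⁺` and `3B⁺/4 ≤ b_k` then `3b_∞/4 ≤ b_k`
(the list `Beta.Assembly.LimitForm.thm2Printed_of_list` consumes is stated with the exact `b_∞`, which the certified
lane only knows through an enclosure). [folklore] -/
theorem list_of_upper {b : ℕ → ℝ} {binf Bplus : ℝ} (hB : binf ≤ Bplus) {k : ℕ} (hk : 3 * Bplus / 4 ≤ b k) :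
    3 * binf / 4 ≤ b k := by
  linarith

/-- **The index threshold served by an enclosure**: if `B⁻ ≤ b_∞` and `c₀θ^{k₂} ≤ B⁻/4` then `c₀θ^{k₂} ≤ b_∞/4`.
[folklore] -/
theorem index_of_lower {binf c₀ θ Bminus : ℝ} (hB : Bminus ≤ binf) {k₂ : ℕ} (hk : c₀ * θ ^ k₂ ≤ Bminus / 4) :
    c₀ * θ ^ k₂ ≤ binf / 4 := by
  linarith

/-- **Explicit index from logarithms, served by an enclosure**: for `0 < c₀`, `0 < θ`, `0 < B⁻ ≤ b_∞`,
`log(c₀/(B⁻/4)) ≤ k₂·log θ⁻¹ ⇒ c₀θ^{k₂} ≤ b_∞/4` (the index inequality of `Assembly.LimitForm.thm2Printed_of_list`, with the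
logarithmic test of `Assembly.LimitForm.geometric_le_of_log` run on the certified lower value `B⁻` instead of the unknown `b_∞`).
[folklore] -/
theorem index_of_log {binf c₀ θ Bminus : ℝ} (hc : 0 < c₀) (hθ : 0 < θ) (hB : 0 < Bminus) (hle : Bminus ≤ binf)
    {k₂ : ℕ} (hn : Real.log (c₀ / (Bminus / 4)) ≤ k₂ * Real.log θ⁻¹) : c₀ * θ ^ k₂ ≤ binf / 4 :=
  index_of_lower hle (Assembly.LimitForm.geometric_le_of_log hc hθ (by positivity) hn)

/-! ## 3. `LimitForm` and Theorem 2 as printed from the rate + certificates (no identification of `β⁰_∞`) -/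

section Assembly

variable {β : HBeta}

/-- **`LimitForm` from a rate about a limit of UNKNOWN sign plus ONE certificate.**  Data: the printed split `S`; a box
size `γ₀`; a `GeomRate S.β0 binf c₀ θ` (asymptotic lane; `binf` any real); ONE certified lower bound `m ≤ β⁰_{k₁+1}`
with `c₀θ^{k₁} < m` (certified lane) — which discharges the field `binf_pos`; the remainder bound (AF-1), continuity
(C) and the printed upper bound (U) as in `Beta.Assembly.LimitForm`. [cite: Balaban1987RG1, (2.12)–(2.14) p.268 and §1 p.264] -/
def limitFormOfCertified (S : B12Beta.OneLoopSplit β) {γ₀ binf c₀ θ Cr β' m : ℝ} {k₁ : ℕ} (hγ₀ : 0 < γ₀)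
    (hθ0 : 0 ≤ θ) (hθ1 : θ < 1) (hconv : GeomRate S.β0 binf c₀ θ) (hcert : m ≤ S.β0 k₁)
    (hgap : c₀ * θ ^ k₁ < m) (hCr : 0 ≤ Cr)
    (haf1 : ∀ k (p : Fin (k + 1) → ℝ), p ∈ B12Beta.HistBox γ₀ k → |S.β1 k p| ≤ Cr * p (Fin.last k))
    (hcont : BetaContH γ₀ β) (hup : BetaUpperH β' γ₀ β) : Assembly.LimitForm β where
  S := S
  γ₀ := γ₀
  γ₀_pos := hγ₀
  binf := binf
  binf_pos := hconv.binf_pos hcert hgap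
  c₀ := c₀
  c₀_nonneg := hconv.const_nonneg
  θ := θ
  θ_nonneg := hθ0
  θ_lt_one := hθ1
  conv := hconv
  Cr := Cr
  Cr_nonneg := hCr
  af1 := haf1
  cont := hcont
  β' := β'
  upper := hup

/-- The constants of `limitFormOfCertified` are the given ones. [folklore] -/
theorem limitFormOfCertified_consts (S : B12Beta.OneLoopSplit β) {γ₀ binf c₀ θ Cr β' m : ℝ} {k₁ : ℕ}
    (hγ₀ : 0 < γ₀) (hθ0 : 0 ≤ θ) (hθ1 : θ < 1) (hconv : GeomRate S.β0 binf c₀ θ) (hcert : m ≤ S.β0 k₁)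
    (hgap : c₀ * θ ^ k₁ < m) (hCr : 0 ≤ Cr)
    (haf1 : ∀ k (p : Fin (k + 1) → ℝ), p ∈ B12Beta.HistBox γ₀ k → |S.β1 k p| ≤ Cr * p (Fin.last k))
    (hcont : BetaContH γ₀ β) (hup : BetaUpperH β' γ₀ β) :
    (limitFormOfCertified S hγ₀ hθ0 hθ1 hconv hcert hgap hCr haf1 hcont hup).binf = binf ∧
      (limitFormOfCertified S hγ₀ hθ0 hθ1 hconv hcert hgap hCr haf1 hcont hup).c₀ = c₀ ∧
      (limitFormOfCertified S hγ₀ hθ0 hθ1 hconv hcert hgap hCr haf1 hcont hup).θ = θ :=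
  ⟨rfl, rfl, rfl⟩

/-- **THEOREM 2 AS PRINTED FROM THE RATE + CERTIFICATES** — the END statement of the cap × asym split of the β
sub-cell, with NO identification of `β⁰_∞` and no transfer statement.  Inputs: the DAG (`ForwardGenerated`), `1 < L`;
the printed split `S`; (asym) a `GeomRate S.β0 binf c₀ θ`, `0 ≤ θ < 1`, about ANY real `binf`; (cap) ONE certified
enclosure `m ≤ β⁰_{k₁+1} ≤ M` with `c₀θ^{k₁} < m`, an index `k₂` with `c₀θ^{k₂} ≤ (m − c₀θ^{k₁})/4`, and the certified
list `3(M + c₀θ^{k₁})/4 ≤ β⁰_{k+1}` for `k < k₂`; (an4) the remainder bound (AF-1) and continuity (C) on `]0,γ₀]`-boxes;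
(printed) the upper bound (U).  Conclusion `B12.Thm2Printed C L`, by `Beta.Assembly.LimitForm.thm2Printed_of_list`.
[cite: Balaban1987RG1, Thm 2 p.259 with (0.31)] -/
theorem thm2Printed_of_certified {C : B12.Construction} (hgen : ForwardGenerated C β) {L : ℝ} (hL : 1 < L)
    (S : B12Beta.OneLoopSplit β) {γ₀ binf c₀ θ Cr β' m M : ℝ} {k₁ k₂ : ℕ} (hγ₀ : 0 < γ₀) (hθ0 : 0 ≤ θ)
    (hθ1 : θ < 1) (hconv : GeomRate S.β0 binf c₀ θ) (hlo : m ≤ S.β0 k₁) (hhi : S.β0 k₁ ≤ M)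
    (hgap : c₀ * θ ^ k₁ < m) (hk₂ : c₀ * θ ^ k₂ ≤ (m - c₀ * θ ^ k₁) / 4)
    (hsmall : ∀ k, k < k₂ → 3 * (M + c₀ * θ ^ k₁) / 4 ≤ S.β0 k) (hCr : 0 ≤ Cr)
    (haf1 : ∀ k (p : Fin (k + 1) → ℝ), p ∈ B12Beta.HistBox γ₀ k → |S.β1 k p| ≤ Cr * p (Fin.last k))
    (hcont : BetaContH γ₀ β) (hup : BetaUpperH β' γ₀ β) : B12.Thm2Printed C L :=
  (limitFormOfCertified S hγ₀ hθ0 hθ1 hconv hlo hgap hCr haf1 hcont hup).thm2Printed_of_list hgen hL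
    (index_of_lower (hconv.binf_ge hlo) hk₂)
    (fun k hk => list_of_upper (hconv.binf_le hhi) (hsmall k hk))

/-- **The same END statement from the CAUCHY form of the rate** (no limit value among the hypotheses at all: `β⁰_∞`
is the constructed `CauchyRate.lim S.β0` and `c₀ = c/(1−θ)`). [cite: Balaban1987RG1, Thm 2 p.259 with (0.31)] -/
theorem thm2Printed_of_cauchyCertified {C : B12.Construction} (hgen : ForwardGenerated C β) {L : ℝ} (hL : 1 < L)
    (S : B12Beta.OneLoopSplit β) {γ₀ c θ Cr β' m M : ℝ} {k₁ k₂ : ℕ} (hγ₀ : 0 < γ₀) (hθ0 : 0 ≤ θ) (hθ1 : θ < 1)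
    (hrate : CauchyRate S.β0 c θ) (hlo : m ≤ S.β0 k₁) (hhi : S.β0 k₁ ≤ M)
    (hgap : c / (1 - θ) * θ ^ k₁ < m) (hk₂ : c / (1 - θ) * θ ^ k₂ ≤ (m - c / (1 - θ) * θ ^ k₁) / 4)
    (hsmall : ∀ k, k < k₂ → 3 * (M + c / (1 - θ) * θ ^ k₁) / 4 ≤ S.β0 k) (hCr : 0 ≤ Cr)
    (haf1 : ∀ k (p : Fin (k + 1) → ℝ), p ∈ B12Beta.HistBox γ₀ k → |S.β1 k p| ≤ Cr * p (Fin.last k))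
    (hcont : BetaContH γ₀ β) (hup : BetaUpperH β' γ₀ β) : B12.Thm2Printed C L :=
  thm2Printed_of_certified hgen hL S hγ₀ hθ0 hθ1 (hrate.geomRate hθ1) hlo hhi hgap hk₂ hsmall hCr haf1 hcont hup

/-- **Discrete asymptotic freedom `BetaAFH β` from the rate + certificates** (same inputs as
`thm2Printed_of_certified` minus the DAG and `L`; (AF-1), (C), (U) remain as the fields of the limit form). [folklore] -/
theorem betaAFH_of_certified (S : B12Beta.OneLoopSplit β) {γ₀ binf c₀ θ Cr β' m M : ℝ} {k₁ k₂ : ℕ}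
    (hγ₀ : 0 < γ₀) (hθ0 : 0 ≤ θ) (hθ1 : θ < 1) (hconv : GeomRate S.β0 binf c₀ θ) (hlo : m ≤ S.β0 k₁)
    (hhi : S.β0 k₁ ≤ M) (hgap : c₀ * θ ^ k₁ < m) (hk₂ : c₀ * θ ^ k₂ ≤ (m - c₀ * θ ^ k₁) / 4)
    (hsmall : ∀ k, k < k₂ → 3 * (M + c₀ * θ ^ k₁) / 4 ≤ S.β0 k) (hCr : 0 ≤ Cr)
    (haf1 : ∀ k (p : Fin (k + 1) → ℝ), p ∈ B12Beta.HistBox γ₀ k → |S.β1 k p| ≤ Cr * p (Fin.last k))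
    (hcont : BetaContH γ₀ β) (hup : BetaUpperH β' γ₀ β) : BetaAFH β := by
  set D := limitFormOfCertified S hγ₀ hθ0 hθ1 hconv hlo hgap hCr haf1 hcont hup with hD
  have hk : D.c₀ * D.θ ^ k₂ ≤ D.binf / 4 := index_of_lower (hconv.binf_ge hlo) hk₂
  have hl : ∀ k, k < k₂ → 3 * D.binf / 4 ≤ D.S.β0 k :=
    fun k hk => list_of_upper (hconv.binf_le hhi) (hsmall k hk)
  exact ⟨D.γ₁, D.γ₁_pos, D.binf / 2, by linarith [D.binf_pos], D.betaLowerH_of_list hk hl⟩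

end Assembly

/-! ## 4. The identification as a corollary (when road (1)'s drift is available); non-vacuity -/

/-- **Cauchy rate + drift ⇒ the constructed limit IS the drift slope**: if `|b_{k+1} − b_k| ≤ cθ^k` (`θ < 1`) and the
partial sums drift like `s·k + O(1)` (`Drift.OneLoopDrift s A b`, road (1) of the sub-cell), then `lim b = s` — by
`Transfer.limit_eq_of_marginalBounded` (Cesàro).  So the identification `β⁰_∞ = stepBal N L` is NOT an independent
input of road (2): it follows from ANY rate plus road (1)'s drift with slope `stepBal N L`. [folklore] -/
theorem CauchyRate.lim_eq_of_drift {b : ℕ → ℝ} {c θ s A : ℝ} (h : CauchyRate b c θ) (hθ1 : θ < 1)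
    (hdrift : Drift.OneLoopDrift s A b) : CauchyRate.lim b = s :=
  Transfer.limit_eq_of_marginalBounded (b := b) (B := s) (R := A)
    (fun k => by have := hdrift k; rwa [mul_comm] at this) (h.tendsto_lim hθ1)

/-- … in particular with slope `stepBal N L` (`N > 0`, `L > 1`) the constructed limit is positive WITHOUT any
certificate. [folklore] -/
theorem CauchyRate.lim_pos_of_drift_stepBal {b : ℕ → ℝ} {c θ A N L : ℝ} (h : CauchyRate b c θ) (hθ1 : θ < 1)
    (hdrift : Drift.OneLoopDrift (B12Normalization.stepBal N L) A b) (hN : 0 < N) (hL : 1 < L) :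
    0 < CauchyRate.lim b := by
  rw [h.lim_eq_of_drift hθ1 hdrift]
  exact B12Normalization.stepBal_pos hN hL

/-- Conversely a `GeomRate` gives the drift form with slope `b_∞` and defect `c₀/(1−θ)` (`Drift.drift_of_geometric`).
[folklore] -/
theorem GeomRate.drift {b : ℕ → ℝ} {binf c₀ θ : ℝ} (h : GeomRate b binf c₀ θ) (hθ0 : 0 ≤ θ) (hθ1 : θ < 1) :
    Drift.OneLoopDrift binf (c₀ / (1 - θ)) b :=
  Drift.drift_of_geometric hθ0 hθ1 h.const_nonneg h

namespace Witness

/-- A toy sequence: `b_k = 1 − 2·(1/2)^k` (`b₀ = −1 < 0`, `b₁ = 0`, `b₂ = 1/2`, increasing to `1`). [folklore] -/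
def b (k : ℕ) : ℝ := 1 - 2 * (1 / 2 : ℝ) ^ k

/-- It has the Cauchy rate `c = 1`, `θ = 1/2`. [folklore] -/
theorem cauchyRate_b : CauchyRate b 1 (1 / 2) := by
  intro k
  have : b (k + 1) - b k = (1 / 2 : ℝ) ^ k := by simp only [b, pow_succ]; ring
  rw [this, one_mul, abs_of_nonneg (by positivity)]

/-- … and the two-ended rate about `1` with `c₀ = 2`. [folklore] -/
theorem geomRate_b : GeomRate b 1 2 (1 / 2) := by
  intro k
  have : b k - 1 = -(2 * (1 / 2 : ℝ) ^ k) := by simp only [b]; ring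
  rw [this, abs_neg, abs_of_nonneg (by positivity)]

/-- NON-VACUITY of §2, and the certificate is NEEDED: the rate alone does not give the sign of every term
(`b₀ = −1 < 0`), while the certificate `m = 3/4 ≤ b₃` at `k₁ = 3` has `2·(c₀θ³) = 2·(2·(1/2)³) = 1/2 < 3/4`, so
`0 < b_k` for all `k ≥ 3` by `GeomRate.tail_pos`. [folklore] -/
theorem tail_pos_b : (b 0 < 0) ∧ ∀ k, 3 ≤ k → 0 < b k := by
  refine ⟨by norm_num [b], fun k hk => ?_⟩
  exact geomRate_b.tail_pos (by norm_num) (by norm_num) (m := 3 / 4) (k₁ := 3) (by norm_num [b]) (by norm_num) hk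

/-- The constructed limit of the toy sequence is `1` (from the drift with slope `1`, defect `4`), illustrating
`CauchyRate.lim_eq_of_drift`. [folklore] -/
theorem lim_b : CauchyRate.lim b = 1 :=
  cauchyRate_b.lim_eq_of_drift (by norm_num) (geomRate_b.drift (by norm_num) (by norm_num))

end Witness

/-! ## 5. Interlock with the certified lane's carrier `Certified.SmallKCert` (v1.1) -/

section CapInterlock

open Certified

/-- **A `SmallKCert` from the rate + ONE certified upper value + a certified list.**  Given a `GeomRate b binf c₀ θ`
(about a `binf` of unknown value), a certified rational upper value `b k₁ ≤ M`, a rational `q ≥ c₀θ^{k₁}` and certified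
rational lower values `lo k ≤ b k` (`k < k₂`) passing the decidable threshold test `3(M + q)/4 ≤ lo k`, the certified
lane's carrier `Certified.SmallKCert b binf` of length `k₂` with `bhi := M + q` — its field `binf_le : binf ≤ bhi` is
DISCHARGED by `GeomRate.binf_le`, not assumed.  Nothing about Bałaban's coefficients is asserted. [folklore] -/
def GeomRate.smallKCert {b : ℕ → ℝ} {binf c₀ θ : ℝ} (h : GeomRate b binf c₀ θ) {k₁ : ℕ} {M q : ℚ}
    (hM : b k₁ ≤ (M : ℝ)) (hq : c₀ * θ ^ k₁ ≤ (q : ℝ)) (k₂ : ℕ) (lo : ℕ → ℚ)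
    (hlo : ∀ k, k < k₂ → ((lo k : ℚ) : ℝ) ≤ b k) (hthr : ∀ k, k < k₂ → 3 * (M + q) / 4 ≤ lo k) :
    SmallKCert b binf where
  k₁ := k₂
  lo := lo
  lo_le := hlo
  bhi := M + q
  binf_le := by
    have := h.binf_le (k₁ := k₁) hM
    push_cast
    linarith
  thr_le := hthr

/-- The length of `GeomRate.smallKCert` is the list length `k₂`. [folklore] -/
theorem GeomRate.smallKCert_k₁ {b : ℕ → ℝ} {binf c₀ θ : ℝ} (h : GeomRate b binf c₀ θ) {k₁ : ℕ} {M q : ℚ}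
    (hM : b k₁ ≤ (M : ℝ)) (hq : c₀ * θ ^ k₁ ≤ (q : ℝ)) (k₂ : ℕ) (lo : ℕ → ℚ)
    (hlo : ∀ k, k < k₂ → ((lo k : ℚ) : ℝ) ≤ b k) (hthr : ∀ k, k < k₂ → 3 * (M + q) / 4 ≤ lo k) :
    (h.smallKCert hM hq k₂ lo hlo hthr).k₁ = k₂ := rfl

variable {β : HBeta}

/-- **THEOREM 2 AS PRINTED THROUGH THE CERTIFIED LANE'S EXPORT** — `Certified.thm2Printed_of_cert` applied to the limit
form `limitFormOfCertified` (whose `binf_pos` comes from ONE certified lower value `m ≤ β⁰_{k₁+1}` with `c₀θ^{k₁} < m`)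
and to ANY certificate `c : SmallKCert S.β0 binf`; the export's rate hypothesis `c₀θ^{c.k₁} ≤ β⁰_∞/4` is DISCHARGED by
the index test `c₀θ^{c.k₁} ≤ (m − c₀θ^{k₁})/4` against the certified lower value (`GeomRate.binf_ge`, `index_of_lower`).
With `c := hconv.smallKCert …` this is `thm2Printed_of_certified` again, now routed through cap3's carrier.
[cite: Balaban1987RG1, Thm 2 p.259 with (0.31)] -/
theorem thm2Printed_of_smallKCert {C : B12.Construction} (hgen : ForwardGenerated C β) {L : ℝ} (hL : 1 < L)
    (S : B12Beta.OneLoopSplit β) {γ₀ binf c₀ θ Cr β' m : ℝ} {k₁ : ℕ} (hγ₀ : 0 < γ₀) (hθ0 : 0 ≤ θ) (hθ1 : θ < 1)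
    (hconv : GeomRate S.β0 binf c₀ θ) (hcert : m ≤ S.β0 k₁) (hgap : c₀ * θ ^ k₁ < m) (hCr : 0 ≤ Cr)
    (haf1 : ∀ k (p : Fin (k + 1) → ℝ), p ∈ B12Beta.HistBox γ₀ k → |S.β1 k p| ≤ Cr * p (Fin.last k))
    (hcont : BetaContH γ₀ β) (hup : BetaUpperH β' γ₀ β) (c : SmallKCert S.β0 binf)
    (hk : c₀ * θ ^ c.k₁ ≤ (m - c₀ * θ ^ k₁) / 4) : B12.Thm2Printed C L :=
  Certified.thm2Printed_of_cert (limitFormOfCertified S hγ₀ hθ0 hθ1 hconv hcert hgap hCr haf1 hcont hup) c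
    (show c₀ * θ ^ c.k₁ ≤ binf / 4 from index_of_lower (hconv.binf_ge hcert) hk) hgen hL

/-- **Positivity of every one-loop coefficient through the export**: `Certified.beta0_pos_all_of_cert` needs a certificate at
least as long as the limit form's minimal index `k₀`; `Assembly.LimitForm.k₀_le` bounds `k₀` by any index passing the
rate test, here discharged against the certified lower value as above. [folklore] -/
theorem beta0_pos_all_of_smallKCert (S : B12Beta.OneLoopSplit β) {γ₀ binf c₀ θ Cr β' m : ℝ} {k₁ : ℕ}
    (hγ₀ : 0 < γ₀) (hθ0 : 0 ≤ θ) (hθ1 : θ < 1) (hconv : GeomRate S.β0 binf c₀ θ) (hcert : m ≤ S.β0 k₁)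
    (hgap : c₀ * θ ^ k₁ < m) (hCr : 0 ≤ Cr)
    (haf1 : ∀ k (p : Fin (k + 1) → ℝ), p ∈ B12Beta.HistBox γ₀ k → |S.β1 k p| ≤ Cr * p (Fin.last k))
    (hcont : BetaContH γ₀ β) (hup : BetaUpperH β' γ₀ β) (c : SmallKCert S.β0 binf)
    (hk : c₀ * θ ^ c.k₁ ≤ (m - c₀ * θ ^ k₁) / 4) : ∀ k, 0 < S.β0 k :=
  Certified.beta0_pos_all_of_cert (limitFormOfCertified S hγ₀ hθ0 hθ1 hconv hcert hgap hCr haf1 hcont hup) c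
    (Assembly.LimitForm.k₀_le _ (show c₀ * θ ^ c.k₁ ≤ binf / 4 from index_of_lower (hconv.binf_ge hcert) hk))

end CapInterlock

/-! ## 6. (v1.2) THE SYMBOL SOCKET — from three zero-momentum curvatures per scale to Theorem 2 as printed ((0.31) p.259)

Composition with `Beta/MomentSymbol` (p184097): the one-loop coefficient (1.22) is `−½×` the polarised curvature at
zero momentum of the kernel's directional symbols (`MomentSymbol.secondMoment_eq_polarization`), so a MOMENTUM-SPACE
one-step rate for the three numbers `D²_{e_μ}, D²_{e_ν}, D²_{e_μ+e_ν}` of the one-loop kernels — the hypothesis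
`SymbolStepRate` below, which is the (OPEN, O-asym1-1 = O-an2-2a/G-an2-4, NOT printed in [B4]–[B12]) large-k input in
the form recommended by ASYM-beta.md R-asym1-2 — is a `CauchyRate` for `S.β0` with constant `(3/2)·c` and feeds §3/§5
unchanged.  No position-space decay constant enters the rate constant.  Every analytic input stays a hypothesis
binder; nothing of the series is discharged here. -/

section SymbolSocket

open Certified

variable {d : ℕ} {β : HBeta}

/-- **(CONV-Π̂) the symbol step rate** (OPEN for Bałaban's kernels; hypothesis shape only): along the kernel sequence
`P k` (intended: `Π⁰_{k+1}` at zero couplings, unit `L^k`-lattice, volume limit taken), the zero-momentum curvatures of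
the directional symbols of the `(μ,ν)` component along `e_μ`, `e_ν`, `e_μ + e_ν` move by at most `c·θ^k` from scale
`k` to `k+1`. [cite: Balaban1987RG1, (1.22) p.264] -/
def SymbolStepRate (P : ℕ → B12Beta.Kernel d) (μ ν : Fin d) (c θ : ℝ) : Prop :=
  ∀ k, ∀ v ∈ ({Pi.single μ 1, Pi.single ν 1, Pi.single μ 1 + Pi.single ν 1} : Set (Fin d → ℤ)),
    |MomentSymbol.dirSymbolD2 (P (k + 1) μ ν) v 0 - MomentSymbol.dirSymbolD2 (P k μ ν) v 0| ≤ c * θ ^ k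

/-- A symbol step rate is a Cauchy rate with constant `(3/2)·c` for any scalar sequence identified with the second
moments (1.22) of the kernels (`MomentSymbol.cauchyRate_secondMoment`). [cite: Balaban1987RG1, (1.22) p.264] -/
theorem SymbolStepRate.cauchyRate {P : ℕ → B12Beta.Kernel d} {μ ν : Fin d} {c θ : ℝ}
    (h : SymbolStepRate P μ ν c θ) (hP : ∀ k, PolarizationSign.MomentSummable (P k) 2) {b : ℕ → ℝ}
    (hb : ∀ k, b k = B12Beta.secondMoment (P k) μ ν) : CauchyRate b (3 / 2 * c) θ := by
  intro k
  rw [hb, hb]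
  exact MomentSymbol.cauchyRate_secondMoment hP μ ν h k

/-- The induced Cauchy constant `(3/2)·c` is `≥ 0`. [folklore] -/
theorem SymbolStepRate.const_nonneg {P : ℕ → B12Beta.Kernel d} {μ ν : Fin d} {c θ : ℝ}
    (h : SymbolStepRate P μ ν c θ) (hP : ∀ k, PolarizationSign.MomentSummable (P k) 2) : 0 ≤ 3 / 2 * c :=
  (h.cauchyRate hP (b := fun k => B12Beta.secondMoment (P k) μ ν) fun _ => rfl).const_nonneg

/-- **END SOCKET (symbol form, certified list): `B12.Thm2Printed C L` (Theorem 2 as printed, (0.31) p.259)** from a symbol step rate for the one-loop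
kernels, the identification `S.β0 k = secondMoment (P k) μ ν` ((1.22) at zero couplings), ONE certified two-sided
enclosure at depth `k₁`, the certified small-k list below `k₂`, and the (AF-1)/(1.23)/upper-bound sockets — by
`thm2Printed_of_cauchyCertified` with `c ↦ (3/2)·c`. [cite: Balaban1987RG1, (1.22) p.264 and Thm 2 p.259 with (0.31)] -/
theorem thm2Printed_of_symbolCertified {C : B12.Construction} (hgen : ForwardGenerated C β) {L : ℝ} (hL : 1 < L)
    (S : B12Beta.OneLoopSplit β) {P : ℕ → B12Beta.Kernel d} {μ ν : Fin d}
    (hP : ∀ k, PolarizationSign.MomentSummable (P k) 2) (hβ0 : ∀ k, S.β0 k = B12Beta.secondMoment (P k) μ ν)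
    {γ₀ c θ Cr β' m M : ℝ} {k₁ k₂ : ℕ} (hγ₀ : 0 < γ₀) (hθ0 : 0 ≤ θ) (hθ1 : θ < 1)
    (hrate : SymbolStepRate P μ ν c θ) (hlo : m ≤ S.β0 k₁) (hhi : S.β0 k₁ ≤ M)
    (hgap : 3 / 2 * c / (1 - θ) * θ ^ k₁ < m)
    (hk₂ : 3 / 2 * c / (1 - θ) * θ ^ k₂ ≤ (m - 3 / 2 * c / (1 - θ) * θ ^ k₁) / 4)
    (hsmall : ∀ k, k < k₂ → 3 * (M + 3 / 2 * c / (1 - θ) * θ ^ k₁) / 4 ≤ S.β0 k) (hCr : 0 ≤ Cr)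
    (haf1 : ∀ k (p : Fin (k + 1) → ℝ), p ∈ B12Beta.HistBox γ₀ k → |S.β1 k p| ≤ Cr * p (Fin.last k))
    (hcont : BetaContH γ₀ β) (hup : BetaUpperH β' γ₀ β) : B12.Thm2Printed C L :=
  thm2Printed_of_cauchyCertified hgen hL S hγ₀ hθ0 hθ1 (hrate.cauchyRate hP hβ0) hlo hhi hgap hk₂ hsmall hCr haf1
    hcont hup

/-- **END SOCKET (symbol form, cap3 carrier): `B12.Thm2Printed C L`** from a symbol step rate, the identification with (1.22), ONE
certified enclosure `m ≤ S.β0 k₁` with `(3/2)c/(1−θ)·θ^{k₁} < m`, and a `Certified.SmallKCert S.β0 (CauchyRate.lim S.β0)`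
reaching an index where the tail bound is below a quarter of the certified limit lower bound — by
`thm2Printed_of_smallKCert` with the geometric rate `CauchyRate.geomRate`. [cite: Balaban1987RG1, (1.22) p.264 and Thm 2 p.259 with (0.31)] -/
theorem thm2Printed_of_symbolSmallKCert {C : B12.Construction} (hgen : ForwardGenerated C β) {L : ℝ} (hL : 1 < L)
    (S : B12Beta.OneLoopSplit β) {P : ℕ → B12Beta.Kernel d} {μ ν : Fin d}
    (hP : ∀ k, PolarizationSign.MomentSummable (P k) 2) (hβ0 : ∀ k, S.β0 k = B12Beta.secondMoment (P k) μ ν)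
    {γ₀ c θ Cr β' m : ℝ} {k₁ : ℕ} (hγ₀ : 0 < γ₀) (hθ0 : 0 ≤ θ) (hθ1 : θ < 1)
    (hrate : SymbolStepRate P μ ν c θ) (hcert : m ≤ S.β0 k₁) (hgap : 3 / 2 * c / (1 - θ) * θ ^ k₁ < m)
    (hCr : 0 ≤ Cr)
    (haf1 : ∀ k (p : Fin (k + 1) → ℝ), p ∈ B12Beta.HistBox γ₀ k → |S.β1 k p| ≤ Cr * p (Fin.last k))
    (hcont : BetaContH γ₀ β) (hup : BetaUpperH β' γ₀ β) (c' : SmallKCert S.β0 (CauchyRate.lim S.β0))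
    (hk : 3 / 2 * c / (1 - θ) * θ ^ c'.k₁ ≤ (m - 3 / 2 * c / (1 - θ) * θ ^ k₁) / 4) : B12.Thm2Printed C L :=
  thm2Printed_of_smallKCert hgen hL S hγ₀ hθ0 hθ1 ((hrate.cauchyRate hP hβ0).geomRate hθ1) hcert hgap hCr haf1
    hcont hup c' hk

/-- … and positivity of EVERY one-loop coefficient from the same data. [cite: Balaban1987RG1, (1.22) p.264] -/
theorem beta0_pos_all_of_symbolSmallKCert (S : B12Beta.OneLoopSplit β) {P : ℕ → B12Beta.Kernel d} {μ ν : Fin d}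
    (hP : ∀ k, PolarizationSign.MomentSummable (P k) 2) (hβ0 : ∀ k, S.β0 k = B12Beta.secondMoment (P k) μ ν)
    {γ₀ c θ Cr β' m : ℝ} {k₁ : ℕ} (hγ₀ : 0 < γ₀) (hθ0 : 0 ≤ θ) (hθ1 : θ < 1)
    (hrate : SymbolStepRate P μ ν c θ) (hcert : m ≤ S.β0 k₁) (hgap : 3 / 2 * c / (1 - θ) * θ ^ k₁ < m)
    (hCr : 0 ≤ Cr)
    (haf1 : ∀ k (p : Fin (k + 1) → ℝ), p ∈ B12Beta.HistBox γ₀ k → |S.β1 k p| ≤ Cr * p (Fin.last k))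
    (hcont : BetaContH γ₀ β) (hup : BetaUpperH β' γ₀ β) (c' : SmallKCert S.β0 (CauchyRate.lim S.β0))
    (hk : 3 / 2 * c / (1 - θ) * θ ^ c'.k₁ ≤ (m - 3 / 2 * c / (1 - θ) * θ ^ k₁) / 4) : ∀ k, 0 < S.β0 k :=
  beta0_pos_all_of_smallKCert S hγ₀ hθ0 hθ1 ((hrate.cauchyRate hP hβ0).geomRate hθ1) hcert hgap hCr haf1 hcont hup
    c' hk

/-- The positivity TAIL alone (no small-k list): a symbol step rate, the identification with (1.22) and one certified
enclosure with `2·(3/2)c/(1−θ)·θ^{k₁} < m` give `0 < S.β0 k` for all `k ≥ k₁` (`GeomRate.tail_pos`). [cite: Balaban1987RG1, (1.22) p.264] -/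
theorem beta0_tail_pos_of_symbolRate (S : B12Beta.OneLoopSplit β) {P : ℕ → B12Beta.Kernel d} {μ ν : Fin d}
    (hP : ∀ k, PolarizationSign.MomentSummable (P k) 2) (hβ0 : ∀ k, S.β0 k = B12Beta.secondMoment (P k) μ ν)
    {c θ m : ℝ} {k₁ : ℕ} (hθ0 : 0 ≤ θ) (hθ1 : θ < 1) (hrate : SymbolStepRate P μ ν c θ) (hcert : m ≤ S.β0 k₁)
    (hgap : 2 * (3 / 2 * c / (1 - θ) * θ ^ k₁) < m) : ∀ k, k₁ ≤ k → 0 < S.β0 k :=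
  fun _k hk => ((hrate.cauchyRate hP hβ0).geomRate hθ1).tail_pos hθ0 hθ1.le hcert hgap hk

end SymbolSocket

/-! ## 7. (v1.3) THE MARGIN FORM — Theorem 2 as printed from the rate + a ONE-SIDED certified list; no enclosure,
no `3/4`-threshold

§3/§5/§6 route the END statement through `Assembly.LimitForm.thm2Printed_of_list`, whose small-k list is stated against
`3β⁰_∞/4` and therefore needs a two-sided certified ENCLOSURE `m ≤ β⁰_{k₁+1} ≤ M` (to major `β⁰_∞` from above) and the
list thresholds `3(M + c₀θ^{k₁})/4 ≤ β⁰_{k+1}`: with `(k₁, k₂) = (0, 1)` that asks `c₀ ≤ min((4m − 3M)/3, m/(1 + 4θ))`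
(`≈ m/3` for a tight enclosure).  The consumer `FlowStepRuns.thm2Printed_of_boxBoundsH` behind it only wants SOME uniform
positive lower bound of the `β_{k+1}` on small boxes, and the rate gives one directly: from `GeomRate S.β0 binf c₀ θ`
(`0 ≤ θ ≤ 1`, `binf` ANY real — never identified, its sign never used) and ONE-SIDED certified lower values
`m ≤ β⁰_{k+1}` for `k ≤ k₁`, every one-loop coefficient is `≥ m − c₀θ^{k₁}(1 + θ)` (`GeomRate.lower_of_list`); so the
single gap inequality `c₀θ^{k₁}(1 + θ) < m` — budget `c₀ < m·θ^{−k₁}/(1 + θ)` — replaces enclosure, index test and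
threshold list, via `Assembly.EventualForm.ofSplitOneSided` with `k₀ := 0` (`eventualFormOfMargin`).  END statements:
`thm2Printed_of_margin` / `_of_cauchyMargin` / `_of_symbolMargin`, `beta0_pos_all_of_margin`, `betaAFH_of_margin`,
`endpointExistence_of_margin`.  For the cap × asym split this is the cheapest interlock: the certified lane supplies
LOWER bounds only (no upper bounds, no rational threshold tests), at the depths `k ≤ k₁` it can reach.  Real analysis
about an arbitrary split; nothing of the series is discharged. -/

section MarginForm

namespace GeomRate

variable {b : ℕ → ℝ} {binf c₀ θ : ℝ}

/-- **The sharp tail from one certified lower value**: for `0 ≤ θ ≤ 1`, `m ≤ b_{k₁}` and `k ≥ k₁`,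
`b_k ≥ m − c₀θ^{k₁}(1 + θ)` (at `k = k₁` the certificate itself; for `k ≥ k₁ + 1`,
`b_k ≥ b_∞ − c₀θ^k ≥ (m − c₀θ^{k₁}) − c₀θ^{k₁+1}`). [folklore] -/
theorem tail_ge_margin (h : GeomRate b binf c₀ θ) (hθ0 : 0 ≤ θ) (hθ1 : θ ≤ 1) {k₁ : ℕ} {m : ℝ} (hm : m ≤ b k₁)
    {k : ℕ} (hk : k₁ ≤ k) : m - c₀ * θ ^ k₁ * (1 + θ) ≤ b k := by
  rcases hk.eq_or_lt with rfl | hlt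
  · have : 0 ≤ c₀ * θ ^ k₁ * (1 + θ) :=
      mul_nonneg (mul_nonneg h.const_nonneg (pow_nonneg hθ0 _)) (by linarith)
    linarith
  · have h1 := h.binf_ge hm
    have h2 := (abs_le.mp (h k)).1
    have hθk : θ ^ k ≤ θ ^ (k₁ + 1) := pow_le_pow_of_le_one hθ0 hθ1 hlt
    have h3 := mul_le_mul_of_nonneg_left hθk h.const_nonneg
    have h4 : c₀ * θ ^ (k₁ + 1) = c₀ * θ ^ k₁ * θ := by ring
    linarith

/-- **A uniform lower bound of the whole sequence from the rate + a ONE-SIDED certified list**: `m ≤ b_k` for `k ≤ k₁`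
⇒ `m − c₀θ^{k₁}(1 + θ) ≤ b_k` for EVERY `k`. [folklore] -/
theorem lower_of_list (h : GeomRate b binf c₀ θ) (hθ0 : 0 ≤ θ) (hθ1 : θ ≤ 1) {k₁ : ℕ} {m : ℝ}
    (hlist : ∀ k, k ≤ k₁ → m ≤ b k) : ∀ k, m - c₀ * θ ^ k₁ * (1 + θ) ≤ b k := fun k =>
  (le_or_gt k k₁).elim
    (fun hk => by
      have : 0 ≤ c₀ * θ ^ k₁ * (1 + θ) :=
        mul_nonneg (mul_nonneg h.const_nonneg (pow_nonneg hθ0 _)) (by linarith)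
      linarith [hlist k hk])
    (fun hk => h.tail_ge_margin hθ0 hθ1 (hlist k₁ le_rfl) hk.le)

/-- **Positivity of EVERY term from the rate, the one-sided list and the gap `c₀θ^{k₁}(1 + θ) < m`.** [folklore] -/
theorem pos_all_of_list (h : GeomRate b binf c₀ θ) (hθ0 : 0 ≤ θ) (hθ1 : θ ≤ 1) {k₁ : ℕ} {m : ℝ}
    (hlist : ∀ k, k ≤ k₁ → m ≤ b k) (hgap : c₀ * θ ^ k₁ * (1 + θ) < m) : ∀ k, 0 < b k := fun k => by
  have := h.lower_of_list hθ0 hθ1 hlist k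
  linarith

/-- Under the gap the (never identified) limit is positive as well: `b_∞ ≥ m − c₀θ^{k₁} > c₀θ^{k₁}θ ≥ 0`. [folklore] -/
theorem binf_pos_of_gap (h : GeomRate b binf c₀ θ) (hθ0 : 0 ≤ θ) {k₁ : ℕ} {m : ℝ} (hm : m ≤ b k₁)
    (hgap : c₀ * θ ^ k₁ * (1 + θ) < m) : 0 < binf := by
  have h1 := h.binf_ge hm
  have : 0 ≤ c₀ * θ ^ k₁ * θ := mul_nonneg (mul_nonneg h.const_nonneg (pow_nonneg hθ0 _)) hθ0
  nlinarith

end GeomRate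

variable {d : ℕ} {β : HBeta}

/-- The margin `b₀ := m − c₀θ^{k₁}(1 + θ)` is positive under the gap. [folklore] -/
theorem margin_pos {c₀ θ m : ℝ} {k₁ : ℕ} (hgap : c₀ * θ ^ k₁ * (1 + θ) < m) : 0 < m - c₀ * θ ^ k₁ * (1 + θ) := by
  linarith

/-- The box of the margin form: `γ := min γ₀ (b₀ / (2(C_r + 1)))`, on which the remainder (AF-1) is `≤ b₀/2` in size.
[folklore] -/
def marginBox (γ₀ Cr b₀ : ℝ) : ℝ := min γ₀ (b₀ / (2 * (Cr + 1)))

/-- `0 < γ`. [folklore] -/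
theorem marginBox_pos {γ₀ Cr b₀ : ℝ} (hγ₀ : 0 < γ₀) (hCr : 0 ≤ Cr) (hb₀ : 0 < b₀) : 0 < marginBox γ₀ Cr b₀ :=
  lt_min hγ₀ (div_pos hb₀ (by linarith))

/-- `γ ≤ γ₀`. [folklore] -/
theorem marginBox_le (γ₀ Cr b₀ : ℝ) : marginBox γ₀ Cr b₀ ≤ γ₀ := min_le_left _ _

/-- `C_r·γ ≤ b₀/2`. [folklore] -/
theorem Cr_mul_marginBox_le {γ₀ Cr b₀ : ℝ} (hCr : 0 ≤ Cr) (hb₀ : 0 < b₀) : Cr * marginBox γ₀ Cr b₀ ≤ b₀ / 2 := by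
  have hC1 : 0 < Cr + 1 := by linarith
  have h3 : Cr / (Cr + 1) ≤ 1 := (div_le_one hC1).mpr (by linarith)
  calc Cr * marginBox γ₀ Cr b₀ ≤ Cr * (b₀ / (2 * (Cr + 1))) := mul_le_mul_of_nonneg_left (min_le_right _ _) hCr
    _ = Cr / (Cr + 1) * (b₀ / 2) := by field_simp
    _ ≤ 1 * (b₀ / 2) := mul_le_mul_of_nonneg_right h3 (by linarith)
    _ = b₀ / 2 := one_mul _

/-- **`EventualForm` OF THE MARGIN FORM.**  Data: the printed split `S`; a box size `γ₀`; a `GeomRate S.β0 binf c₀ θ` with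
`0 ≤ θ ≤ 1` about ANY real `binf` (asymptotic lane); ONE-SIDED certified lower values `m ≤ β⁰_{k+1}` for `k ≤ k₁`
(certified lane) and the gap `c₀θ^{k₁}(1 + θ) < m`; the remainder bound (AF-1) with constant `C_r`, continuity (C) and the
printed upper bound (U) on `]0,γ₀]`-boxes.  Output: the minimal form of `Beta.Assembly` with `b := b₀/2`,
`b₀ := m − c₀θ^{k₁}(1 + θ)`, threshold scale `k₀ := 0` and box `]0, min γ₀ (b₀/(2(C_r + 1)))]` — by
`Assembly.EventualForm.ofSplitOneSided`: `2b ≤ β⁰_{k+1}` for all `k` is `GeomRate.lower_of_list`, `−b ≤ β¹_{k+1}` on the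
box is (AF-1) with `C_r γ ≤ b₀/2`, and `−β′ ≤ β_{k+1}` because `β_{k+1} ≥ b₀/2 > 0` there while `β_{k+1} ≤ β′`.
[cite: Balaban1987RG1, (2.12)–(2.14) p.268 and §1 p.264] -/
def eventualFormOfMargin (S : B12Beta.OneLoopSplit β) {γ₀ binf c₀ θ Cr β' m : ℝ} {k₁ : ℕ} (hγ₀ : 0 < γ₀)
    (hθ0 : 0 ≤ θ) (hθ1 : θ ≤ 1) (hconv : GeomRate S.β0 binf c₀ θ) (hlist : ∀ k, k ≤ k₁ → m ≤ S.β0 k)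
    (hgap : c₀ * θ ^ k₁ * (1 + θ) < m) (hCr : 0 ≤ Cr)
    (haf1 : ∀ k (p : Fin (k + 1) → ℝ), p ∈ B12Beta.HistBox γ₀ k → |S.β1 k p| ≤ Cr * p (Fin.last k))
    (hcont : BetaContH γ₀ β) (hup : BetaUpperH β' γ₀ β) : Assembly.EventualForm β :=
  Assembly.EventualForm.ofSplitOneSided S (γ₀ := marginBox γ₀ Cr (m - c₀ * θ ^ k₁ * (1 + θ)))
    (b := (m - c₀ * θ ^ k₁ * (1 + θ)) / 2) (β' := β') (k₀ := 0)
    (marginBox_pos hγ₀ hCr (margin_pos hgap)) (half_pos (margin_pos hgap))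
    (fun k _ => by have := hconv.lower_of_list hθ0 hθ1 hlist k; linarith)
    (fun k _ v hv => by
      have hvγ : v (Fin.last k) ≤ marginBox γ₀ Cr (m - c₀ * θ ^ k₁ * (1 + θ)) := (mem_box.mp hv (Fin.last k)).2
      have h1 := haf1 k v (histBox_of_mem_box (Assembly.LimitForm.box_mono (marginBox_le _ _ _) hv))
      have h2 : Cr * v (Fin.last k) ≤ Cr * marginBox γ₀ Cr (m - c₀ * θ ^ k₁ * (1 + θ)) :=
        mul_le_mul_of_nonneg_left hvγ hCr
      have h3 := Cr_mul_marginBox_le (γ₀ := γ₀) hCr (margin_pos hgap)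
      have h4 := (abs_le.mp (h1.trans (h2.trans h3))).1
      linarith)
    (fun k v hv => hup k v (Assembly.LimitForm.box_mono (marginBox_le _ _ _) hv))
    (fun k v hv => by
      have hvγ : v (Fin.last k) ≤ marginBox γ₀ Cr (m - c₀ * θ ^ k₁ * (1 + θ)) := (mem_box.mp hv (Fin.last k)).2
      have h0 := hconv.lower_of_list hθ0 hθ1 hlist k
      have h1 := haf1 k v (histBox_of_mem_box (Assembly.LimitForm.box_mono (marginBox_le _ _ _) hv))
      have h2 : Cr * v (Fin.last k) ≤ Cr * marginBox γ₀ Cr (m - c₀ * θ ^ k₁ * (1 + θ)) :=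
        mul_le_mul_of_nonneg_left hvγ hCr
      have h3 := Cr_mul_marginBox_le (γ₀ := γ₀) hCr (margin_pos hgap)
      have h4 := (abs_le.mp (h1.trans (h2.trans h3))).1
      have h5 := hup k v (Assembly.LimitForm.box_mono (marginBox_le _ _ _) hv)
      have h6 := S.split k v
      have h7 := margin_pos hgap
      linarith)
    (fun k => (hcont k).mono fun _ hv => Assembly.LimitForm.box_mono (marginBox_le _ _ _) hv)

/-- Its constants: `b = b₀/2`, `k₀ = 0`, box `marginBox γ₀ C_r b₀`. [folklore] -/
theorem eventualFormOfMargin_consts (S : B12Beta.OneLoopSplit β) {γ₀ binf c₀ θ Cr β' m : ℝ} {k₁ : ℕ}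
    (hγ₀ : 0 < γ₀) (hθ0 : 0 ≤ θ) (hθ1 : θ ≤ 1) (hconv : GeomRate S.β0 binf c₀ θ)
    (hlist : ∀ k, k ≤ k₁ → m ≤ S.β0 k) (hgap : c₀ * θ ^ k₁ * (1 + θ) < m) (hCr : 0 ≤ Cr)
    (haf1 : ∀ k (p : Fin (k + 1) → ℝ), p ∈ B12Beta.HistBox γ₀ k → |S.β1 k p| ≤ Cr * p (Fin.last k))
    (hcont : BetaContH γ₀ β) (hup : BetaUpperH β' γ₀ β) :
    (eventualFormOfMargin S hγ₀ hθ0 hθ1 hconv hlist hgap hCr haf1 hcont hup).b = (m - c₀ * θ ^ k₁ * (1 + θ)) / 2 ∧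
      (eventualFormOfMargin S hγ₀ hθ0 hθ1 hconv hlist hgap hCr haf1 hcont hup).k₀ = 0 ∧
      (eventualFormOfMargin S hγ₀ hθ0 hθ1 hconv hlist hgap hCr haf1 hcont hup).γ₀ =
        marginBox γ₀ Cr (m - c₀ * θ ^ k₁ * (1 + θ)) :=
  ⟨rfl, rfl, rfl⟩

/-- **THEOREM 2 AS PRINTED — THE MARGIN FORM (the cheapest cap × asym interlock).**  Inputs: the DAG
(`ForwardGenerated`), `1 < L`; the printed split `S`; (asym) a `GeomRate S.β0 binf c₀ θ`, `0 ≤ θ ≤ 1`, about ANY real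
`binf`; (cap) ONE-SIDED certified lower values `m ≤ β⁰_{k+1}` for the depths `k ≤ k₁` and the single gap inequality
`c₀θ^{k₁}(1 + θ) < m` (budget `c₀ < m·θ^{−k₁}/(1 + θ)`) — NO upper certified value, NO index test, NO threshold list;
(an4) (AF-1) and (C); (printed) (U).  Conclusion `B12.Thm2Printed C L`, by `Assembly.EventualForm.thm2Printed_of_list` on
`eventualFormOfMargin` with the EMPTY list (`k₀ = 0`). [cite: Balaban1987RG1, Thm 2 p.259 with (0.31)] -/
theorem thm2Printed_of_margin {C : B12.Construction} (hgen : ForwardGenerated C β) {L : ℝ} (hL : 1 < L)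
    (S : B12Beta.OneLoopSplit β) {γ₀ binf c₀ θ Cr β' m : ℝ} {k₁ : ℕ} (hγ₀ : 0 < γ₀) (hθ0 : 0 ≤ θ) (hθ1 : θ ≤ 1)
    (hconv : GeomRate S.β0 binf c₀ θ) (hlist : ∀ k, k ≤ k₁ → m ≤ S.β0 k) (hgap : c₀ * θ ^ k₁ * (1 + θ) < m)
    (hCr : 0 ≤ Cr)
    (haf1 : ∀ k (p : Fin (k + 1) → ℝ), p ∈ B12Beta.HistBox γ₀ k → |S.β1 k p| ≤ Cr * p (Fin.last k))
    (hcont : BetaContH γ₀ β) (hup : BetaUpperH β' γ₀ β) : B12.Thm2Printed C L :=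
  (eventualFormOfMargin S hγ₀ hθ0 hθ1 hconv hlist hgap hCr haf1 hcont hup).thm2Printed_of_list hgen hL
    fun k hk => absurd hk (Nat.not_lt_zero k)

/-- **The margin form from the CAUCHY shape of the rate** (`c₀ = c/(1−θ)`, `θ < 1`; the constructed limit never appears).
[cite: Balaban1987RG1, Thm 2 p.259 with (0.31)] -/
theorem thm2Printed_of_cauchyMargin {C : B12.Construction} (hgen : ForwardGenerated C β) {L : ℝ} (hL : 1 < L)
    (S : B12Beta.OneLoopSplit β) {γ₀ c θ Cr β' m : ℝ} {k₁ : ℕ} (hγ₀ : 0 < γ₀) (hθ0 : 0 ≤ θ) (hθ1 : θ < 1)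
    (hrate : CauchyRate S.β0 c θ) (hlist : ∀ k, k ≤ k₁ → m ≤ S.β0 k)
    (hgap : c / (1 - θ) * θ ^ k₁ * (1 + θ) < m) (hCr : 0 ≤ Cr)
    (haf1 : ∀ k (p : Fin (k + 1) → ℝ), p ∈ B12Beta.HistBox γ₀ k → |S.β1 k p| ≤ Cr * p (Fin.last k))
    (hcont : BetaContH γ₀ β) (hup : BetaUpperH β' γ₀ β) : B12.Thm2Printed C L :=
  thm2Printed_of_margin hgen hL S hγ₀ hθ0 hθ1.le (hrate.geomRate hθ1) hlist hgap hCr haf1 hcont hup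

/-- **The margin form through the SYMBOL SOCKET of §6** (`c₀ = (3/2)c/(1−θ)`): a symbol step rate for the one-loop kernels,
the identification `S.β0 k = secondMoment (P k) μ ν` ((1.22) at zero couplings), one-sided certified lower values for
`k ≤ k₁`, the gap, and the (AF-1)/(C)/(U) sockets. [cite: Balaban1987RG1, (1.22) p.264 and Thm 2 p.259 with (0.31)] -/
theorem thm2Printed_of_symbolMargin {C : B12.Construction} (hgen : ForwardGenerated C β) {L : ℝ} (hL : 1 < L)
    (S : B12Beta.OneLoopSplit β) {P : ℕ → B12Beta.Kernel d} {μ ν : Fin d}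
    (hP : ∀ k, PolarizationSign.MomentSummable (P k) 2) (hβ0 : ∀ k, S.β0 k = B12Beta.secondMoment (P k) μ ν)
    {γ₀ c θ Cr β' m : ℝ} {k₁ : ℕ} (hγ₀ : 0 < γ₀) (hθ0 : 0 ≤ θ) (hθ1 : θ < 1) (hrate : SymbolStepRate P μ ν c θ)
    (hlist : ∀ k, k ≤ k₁ → m ≤ S.β0 k) (hgap : 3 / 2 * c / (1 - θ) * θ ^ k₁ * (1 + θ) < m) (hCr : 0 ≤ Cr)
    (haf1 : ∀ k (p : Fin (k + 1) → ℝ), p ∈ B12Beta.HistBox γ₀ k → |S.β1 k p| ≤ Cr * p (Fin.last k))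
    (hcont : BetaContH γ₀ β) (hup : BetaUpperH β' γ₀ β) : B12.Thm2Printed C L :=
  thm2Printed_of_cauchyMargin hgen hL S hγ₀ hθ0 hθ1 (hrate.cauchyRate hP hβ0) hlist hgap hCr haf1 hcont hup

/-- **Positivity of EVERY one-loop coefficient** from the rate, the one-sided list and the gap alone (no (AF-1)/(C)/(U),
no DAG). [folklore] -/
theorem beta0_pos_all_of_margin (S : B12Beta.OneLoopSplit β) {binf c₀ θ m : ℝ} {k₁ : ℕ} (hθ0 : 0 ≤ θ) (hθ1 : θ ≤ 1)
    (hconv : GeomRate S.β0 binf c₀ θ) (hlist : ∀ k, k ≤ k₁ → m ≤ S.β0 k) (hgap : c₀ * θ ^ k₁ * (1 + θ) < m) :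
    ∀ k, 0 < S.β0 k :=
  hconv.pos_all_of_list hθ0 hθ1 hlist hgap

/-- … with the explicit uniform lower bound `m − c₀θ^{k₁}(1 + θ) ≤ β⁰_{k+1}` for all `k`. [folklore] -/
theorem beta0_lower_all_of_margin (S : B12Beta.OneLoopSplit β) {binf c₀ θ m : ℝ} {k₁ : ℕ} (hθ0 : 0 ≤ θ)
    (hθ1 : θ ≤ 1) (hconv : GeomRate S.β0 binf c₀ θ) (hlist : ∀ k, k ≤ k₁ → m ≤ S.β0 k) :
    ∀ k, m - c₀ * θ ^ k₁ * (1 + θ) ≤ S.β0 k :=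
  hconv.lower_of_list hθ0 hθ1 hlist

/-- **Discrete asymptotic freedom `BetaAFH β` from the margin form** (witness box `marginBox γ₀ C_r b₀`, constant `b₀/2`).
[folklore] -/
theorem betaAFH_of_margin (S : B12Beta.OneLoopSplit β) {γ₀ binf c₀ θ Cr β' m : ℝ} {k₁ : ℕ} (hγ₀ : 0 < γ₀)
    (hθ0 : 0 ≤ θ) (hθ1 : θ ≤ 1) (hconv : GeomRate S.β0 binf c₀ θ) (hlist : ∀ k, k ≤ k₁ → m ≤ S.β0 k)
    (hgap : c₀ * θ ^ k₁ * (1 + θ) < m) (hCr : 0 ≤ Cr)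
    (haf1 : ∀ k (p : Fin (k + 1) → ℝ), p ∈ B12Beta.HistBox γ₀ k → |S.β1 k p| ≤ Cr * p (Fin.last k))
    (hcont : BetaContH γ₀ β) (hup : BetaUpperH β' γ₀ β) : BetaAFH β := by
  set E := eventualFormOfMargin S hγ₀ hθ0 hθ1 hconv hlist hgap hCr haf1 hcont hup with hE
  exact ⟨E.γ₀, E.γ₀_pos, E.b, E.b_pos, E.betaLowerH_of_list fun k hk => absurd hk (Nat.not_lt_zero k)⟩

/-- **Endpoint existence (Theorem 2, first sentence) from the margin form.** [cite: Balaban1987RG1, Thm 2 p.259 (first sentence)] -/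
theorem endpointExistence_of_margin (S : B12Beta.OneLoopSplit β) {γ₀ binf c₀ θ Cr β' m : ℝ} {k₁ : ℕ}
    (hγ₀ : 0 < γ₀) (hθ0 : 0 ≤ θ) (hθ1 : θ ≤ 1) (hconv : GeomRate S.β0 binf c₀ θ)
    (hlist : ∀ k, k ≤ k₁ → m ≤ S.β0 k) (hgap : c₀ * θ ^ k₁ * (1 + θ) < m) (hCr : 0 ≤ Cr)
    (haf1 : ∀ k (p : Fin (k + 1) → ℝ), p ∈ B12Beta.HistBox γ₀ k → |S.β1 k p| ≤ Cr * p (Fin.last k))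
    (hcont : BetaContH γ₀ β) (hup : BetaUpperH β' γ₀ β) {C : B12.Construction} (hgen : ForwardGenerated C β) :
    EndpointExistence C :=
  (eventualFormOfMargin S hγ₀ hθ0 hθ1 hconv hlist hgap hCr haf1 hcont hup).endpointExistence hgen

/-- The margin form IMPLIES the data of the certificate road of §3 whenever an upper certified value is also known: its
`LimitForm` is `limitFormOfCertified` with the gap weakened to `c₀θ^{k₁} < m` (for `θ < 1`). [folklore] -/
theorem gap_of_marginGap {c₀ θ m : ℝ} {k₁ : ℕ} (hc₀ : 0 ≤ c₀) (hθ0 : 0 ≤ θ) (hgap : c₀ * θ ^ k₁ * (1 + θ) < m) :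
    c₀ * θ ^ k₁ < m := by
  have : 0 ≤ c₀ * θ ^ k₁ * θ := mul_nonneg (mul_nonneg hc₀ (pow_nonneg hθ0 _)) hθ0
  nlinarith

namespace Witness

/-- Non-vacuity of the margin hypotheses with a genuinely k-dependent sequence: `b_k := 1 + (1/2)^k` has
`GeomRate b 1 1 (1/2)`, the one-sided list `1 ≤ b_k` (all `k`, so `k ≤ 1`), and the gap at `k₁ = 1`:
`1·(1/2)·(3/2) = 3/4 < 1` (at `k₁ = 0` the gap `3/2 < 1` fails — one more certified depth buys the factor `θ⁻¹`). [folklore] -/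
theorem margin_nonvacuous :
    ∃ (b : ℕ → ℝ) (binf c₀ θ m : ℝ) (k₁ : ℕ), GeomRate b binf c₀ θ ∧ 0 < θ ∧ θ < 1 ∧
      (∀ k, k ≤ k₁ → m ≤ b k) ∧ c₀ * θ ^ k₁ * (1 + θ) < m ∧ ¬ c₀ * θ ^ 0 * (1 + θ) < m := by
  refine ⟨fun k => 1 + (1 / 2 : ℝ) ^ k, 1, 1, 1 / 2, 1, 1, ?_, by norm_num, by norm_num, ?_, by norm_num, by norm_num⟩
  · intro k
    simp only [add_sub_cancel_left, one_mul]
    exact le_of_eq (abs_of_nonneg (by positivity))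
  · intro k _
    have : 0 ≤ (1 / 2 : ℝ) ^ k := by positivity
    linarith

end Witness

end MarginForm

end

/-! ## 8. THE STRIP SOCKET (momentum route (S2) of R-asym1-2): circle sup-rates of the complexified symbols ⇒
`SymbolStepRate` with constant `2c/R²` (Cauchy) ⇒ `CauchyRate S.β0 (3c/R²) θ` ⇒ Theorem 2 as printed by the margin form -/

section StripSocket

variable {d : ℕ}
open MomentSymbol (dirSymbolC ExpMoment)

/-- **STRIP STEP RATE** — the OPEN large-`k` input in its MOMENTUM form on a complex circle of radius `R`: for the three
directions `v ∈ {e_μ, e_ν, e_μ + e_ν}` and every `z` with `‖z‖ = R`, the complexified directional symbols of the `(μ,ν)`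
components of consecutive kernels differ by at most `c·θ^k`.  A hypothesis SHAPE (never asserted for Bałaban's kernels;
cell item O-asym1-1). [cite: Balaban1987RG1, (1.22) p.264] -/
def StripStepRate (P : ℕ → B12Beta.Kernel d) (μ ν : Fin d) (R c θ : ℝ) : Prop :=
  ∀ k, ∀ v ∈ ({Pi.single μ 1, Pi.single ν 1, Pi.single μ 1 + Pi.single ν 1} : Set (Fin d → ℤ)),
    ∀ z ∈ Metric.sphere (0 : ℂ) R, ‖dirSymbolC (P (k + 1) μ ν) v z - dirSymbolC (P k μ ν) v z‖ ≤ c * θ ^ k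

/-- **Cauchy's estimate turns a strip step rate into a symbol step rate with constant `2c/R²`** — no position-space
decay constant `Σ_x |x|² e^{−δ|x|}` enters. [folklore] -/
theorem StripStepRate.symbolStepRate {P : ℕ → B12Beta.Kernel d} {μ ν : Fin d} {R c θ : ℝ}
    (h : StripStepRate P μ ν R c θ) (hR : 0 < R) (hP : ∀ k, PolarizationSign.MomentSummable (P k) 2)
    (hE : ∀ k, ∀ v ∈ ({Pi.single μ 1, Pi.single ν 1, Pi.single μ 1 + Pi.single ν 1} : Set (Fin d → ℤ)),
      ExpMoment (P k μ ν) v R) :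
    SymbolStepRate P μ ν (2 * c / R ^ 2) θ := by
  intro k v hv
  have hf1 := hP (k + 1) μ ν
  have hf0 := hP k μ ν
  rw [← MomentSymbol.dirSymbolD2_zero_sub hf1 hf0 v]
  have hEd : ExpMoment (fun x => P (k + 1) μ ν x - P k μ ν x) v R := (hE (k + 1) v hv).sub (hE k v hv)
  have hfd := MomentSymbol.summable_moment_sub hf1 hf0
  have hs : ∀ z ∈ Metric.sphere (0 : ℂ) R,
      ‖dirSymbolC (fun x => P (k + 1) μ ν x - P k μ ν x) v z‖ ≤ c * θ ^ k := by
    intro z hz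
    have hz' : ‖z‖ ≤ R := by
      have : ‖z‖ = R := by simpa using hz
      exact this.le
    rw [MomentSymbol.dirSymbolC_sub (hE (k + 1) v hv) (hE k v hv) hz']
    exact h k v hv z hz
  have := MomentSymbol.abs_dirSymbolD2_zero_le_of_sphere hfd hEd hR hs
  calc |MomentSymbol.dirSymbolD2 (fun x => P (k + 1) μ ν x - P k μ ν x) v 0|
      ≤ 2 * (c * θ ^ k) / R ^ 2 := this
    _ = 2 * c / R ^ 2 * θ ^ k := by ring

/-- … hence a Cauchy rate with constant `3c/R²` for the identified one-loop coefficients. [folklore] -/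
theorem StripStepRate.cauchyRate {P : ℕ → B12Beta.Kernel d} {μ ν : Fin d} {R c θ : ℝ}
    (h : StripStepRate P μ ν R c θ) (hR : 0 < R) (hP : ∀ k, PolarizationSign.MomentSummable (P k) 2)
    (hE : ∀ k, ∀ v ∈ ({Pi.single μ 1, Pi.single ν 1, Pi.single μ 1 + Pi.single ν 1} : Set (Fin d → ℤ)),
      ExpMoment (P k μ ν) v R)
    {b : ℕ → ℝ} (hb : ∀ k, b k = B12Beta.secondMoment (P k) μ ν) : CauchyRate b (3 * c / R ^ 2) θ := by
  have h1 := (h.symbolStepRate hR hP hE).cauchyRate hP hb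
  intro k
  have := h1 k
  calc |b (k + 1) - b k| ≤ 3 / 2 * (2 * c / R ^ 2) * θ ^ k := this
    _ = 3 * c / R ^ 2 * θ ^ k := by ring

/-- For `μ ≠ ν` the three directions have coordinates in `{0, 1}`: `|v_i| ≤ 1`. [folklore] -/
theorem dirs_abs_le_one {μ ν : Fin d} (hne : μ ≠ ν) :
    ∀ v ∈ ({Pi.single μ 1, Pi.single ν 1, Pi.single μ 1 + Pi.single ν 1} : Set (Fin d → ℤ)),
      ∀ i, |((v i : ℤ) : ℝ)| ≤ 1 := by
  intro v hv i
  simp only [Set.mem_insert_iff, Set.mem_singleton_iff] at hv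
  rcases hv with rfl | rfl | rfl
  · by_cases h : i = μ
    · subst h; simp
    · simp [h]
  · by_cases h : i = ν
    · subst h; simp
    · simp [h]
  · by_cases h1 : i = μ
    · subst h1
      simp [hne]
    · by_cases h2 : i = ν
      · subst h2
        simp [h1]
      · simp [h1, h2]

/-- **The exponential moments from the printed decay (5.10)**, for every radius `R < δ₁` (`μ ≠ ν`).
[cite: Balaban1987RG1, (5.10) p.293] -/
theorem expMoments_of_decay510 {P : ℕ → B12Beta.Kernel d} {μ ν : Fin d} (hne : μ ≠ ν) {C δ₁ R : ℝ}
    (hdec : ∀ k, B12Sec2to5.Decay510 (P k μ ν) C δ₁) (hR0 : 0 ≤ R) (hR : R < δ₁) :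
    ∀ k, ∀ v ∈ ({Pi.single μ 1, Pi.single ν 1, Pi.single μ 1 + Pi.single ν 1} : Set (Fin d → ℤ)),
      ExpMoment (P k μ ν) v R := fun k v hv =>
  MomentSymbol.expMoment_of_decay510 (hdec k) (dirs_abs_le_one hne v hv) hR0 (by simpa using hR)

/-- **B12 Theorem 2 AS PRINTED from a strip step rate** (momentum route (S2), margin form §7): the rate constant that
enters the cap budget is `c₀ = 3c/(R²(1−θ))`. [cite: Balaban1987RG1, RG equations (0.17)–(0.20) p.255; Thm 2 p.259 with (0.31)] -/
theorem thm2Printed_of_stripMargin {β : (k : ℕ) → (Fin (k + 1) → ℝ) → ℝ} {C : B12.Construction}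
    (hgen : ForwardGenerated C β) {L : ℝ} (hL : 1 < L) (S : B12Beta.OneLoopSplit β) {P : ℕ → B12Beta.Kernel d}
    {μ ν : Fin d} (hP : ∀ k, PolarizationSign.MomentSummable (P k) 2)
    (hβ0 : ∀ k, S.β0 k = B12Beta.secondMoment (P k) μ ν) {γ₀ R c θ Cr β' m : ℝ} {k₁ : ℕ} (hγ₀ : 0 < γ₀)
    (hR : 0 < R) (hθ0 : 0 ≤ θ) (hθ1 : θ < 1) (hrate : StripStepRate P μ ν R c θ)
    (hE : ∀ k, ∀ v ∈ ({Pi.single μ 1, Pi.single ν 1, Pi.single μ 1 + Pi.single ν 1} : Set (Fin d → ℤ)),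
      ExpMoment (P k μ ν) v R)
    (hlist : ∀ k, k ≤ k₁ → m ≤ S.β0 k) (hgap : 3 * c / R ^ 2 / (1 - θ) * θ ^ k₁ * (1 + θ) < m) (hCr : 0 ≤ Cr)
    (haf1 : ∀ k (p : Fin (k + 1) → ℝ), p ∈ B12Beta.HistBox γ₀ k → |S.β1 k p| ≤ Cr * p (Fin.last k))
    (hcont : BetaContH γ₀ β) (hup : BetaUpperH β' γ₀ β) : B12.Thm2Printed C L :=
  thm2Printed_of_cauchyMargin hgen hL S hγ₀ hθ0 hθ1 (hrate.cauchyRate hR hP hE hβ0) hlist hgap hCr haf1 hcont hup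

/-- **Positivity of every `β⁰_{k+1}` from a strip step rate**, the one-sided list and the gap. [folklore] -/
theorem beta0_pos_all_of_stripMargin {β : (k : ℕ) → (Fin (k + 1) → ℝ) → ℝ} (S : B12Beta.OneLoopSplit β)
    {P : ℕ → B12Beta.Kernel d} {μ ν : Fin d} (hP : ∀ k, PolarizationSign.MomentSummable (P k) 2)
    (hβ0 : ∀ k, S.β0 k = B12Beta.secondMoment (P k) μ ν) {R c θ m : ℝ} {k₁ : ℕ} (hR : 0 < R) (hθ0 : 0 ≤ θ)
    (hθ1 : θ < 1) (hrate : StripStepRate P μ ν R c θ)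
    (hE : ∀ k, ∀ v ∈ ({Pi.single μ 1, Pi.single ν 1, Pi.single μ 1 + Pi.single ν 1} : Set (Fin d → ℤ)),
      ExpMoment (P k μ ν) v R)
    (hlist : ∀ k, k ≤ k₁ → m ≤ S.β0 k) (hgap : 3 * c / R ^ 2 / (1 - θ) * θ ^ k₁ * (1 + θ) < m) :
    ∀ k, 0 < S.β0 k :=
  beta0_pos_all_of_margin S hθ0 hθ1.le ((hrate.cauchyRate hR hP hE hβ0).geomRate hθ1) hlist hgap

end StripSocket

/-! ## 9. THE REAL-ZONE SOCKET (v1.5; three-lines upgrade of §8, `MomentSymbol` §6): a REAL-momentum step rate of the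
directional symbols + the k-UNIFORM strip bound that the printed decay (5.10) gives for free ⇒ a strip step rate on every
smaller circle `‖z‖ = r < R` with ratio `θ^{1−r/R}` and constant `c^{1−r/R}(2M)^{r/R}` (Hadamard three lines) ⇒ §8 ⇒
Theorem 2 as printed.  READING FOR SUPPLIERS: King-shape rates on the REAL Brillouin zone ([King1986] = C. King, CMP 102 (1986)
649–677, Prop. 3.10 (3.91) p. 669, Lemma 4.4 (4.29) p. 673) for the U = 1 primitives, composed through the dictionary,
ARE ENOUGH for β — no complex momenta in
your proofs; the price is the exponent loss `1 − r/R` (e.g. `r = R/2`: ratio `√θ`, constant `√(2Mc)`, budget constant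
`c₀ = 12√(2Mc)/(R²(1−√θ))`). -/

section RealSocket

variable {d : ℕ}
open MomentSymbol (dirSymbol dirSymbolC ExpMoment)

/-- **REAL STEP RATE** — the OPEN large-`k` input in its weakest, REAL-momentum form: along the three directions
`v ∈ {e_μ, e_ν, e_μ + e_ν}` and for every real `t`, the directional symbols (restrictions of the lattice Fourier
transforms to the line `p = t·v`) of the `(μ,ν)` components of consecutive kernels differ by at most `c·θ^k`.  A
hypothesis SHAPE (never asserted for Bałaban's kernels; cell item O-asym1-1); by `2π`-periodicity in `t` it is a
statement on the Brillouin zone. [cite: Balaban1987RG1, (1.22) p.264] -/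
def RealStepRate (P : ℕ → B12Beta.Kernel d) (μ ν : Fin d) (c θ : ℝ) : Prop :=
  ∀ k, ∀ v ∈ ({Pi.single μ 1, Pi.single ν 1, Pi.single μ 1 + Pi.single ν 1} : Set (Fin d → ℤ)),
    ∀ t : ℝ, |dirSymbol (P (k + 1) μ ν) v t - dirSymbol (P k μ ν) v t| ≤ c * θ ^ k

/-- **UNIFORM STRIP BOUND**: every complexified directional symbol is bounded by `M` on the closed strip `|Im z| ≤ R`,
uniformly in `k` (supplied by the printed UNIFORM decay (5.10): `stripBound_of_decay510`). [folklore] -/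
def StripBound (P : ℕ → B12Beta.Kernel d) (μ ν : Fin d) (R M : ℝ) : Prop :=
  ∀ k, ∀ v ∈ ({Pi.single μ 1, Pi.single ν 1, Pi.single μ 1 + Pi.single ν 1} : Set (Fin d → ℤ)),
    ∀ z : ℂ, |z.im| ≤ R → ‖dirSymbolC (P k μ ν) v z‖ ≤ M

/-- **The strip bound from (5.10)** with the explicit constant `M = C · Σ_x e^{−(δ₁−R)|x|₁}`, any `0 ≤ R < δ₁`, `μ ≠ ν`.
[cite: Balaban1987RG1, (5.10) p.293] -/
theorem stripBound_of_decay510 {P : ℕ → B12Beta.Kernel d} {μ ν : Fin d} (hne : μ ≠ ν) {C δ₁ R : ℝ}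
    (hdec : ∀ k, B12Sec2to5.Decay510 (P k μ ν) C δ₁) (hR0 : 0 ≤ R) (hR : R < δ₁) :
    StripBound P μ ν R (C * ∑' x : Fin d → ℤ, Real.exp (-(δ₁ - R) * B12Sec2to5.l1 x)) := by
  intro k v hv z hz
  have h := MomentSymbol.norm_dirSymbolC_le_of_decay510 (hdec k) (dirs_abs_le_one hne v hv) hR0
    (by simpa using hR) hz
  simpa using h

/-- **THE THREE-LINES UPGRADE.** A real step rate `(c, θ)` (`0 < c`, `0 < θ ≤ 1`), a uniform strip bound `M` of
radius `R` with `c ≤ 2M`, and the exponential moments of radius `R` give, on every circle `‖z‖ = r ≤ R`, the strip step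
rate with constant `c^{1−r/R}(2M)^{r/R}` and ratio `θ^{1−r/R}`. [folklore] (Hadamard three-lines theorem.) -/
theorem RealStepRate.stripStepRate {P : ℕ → B12Beta.Kernel d} {μ ν : Fin d} {c θ R M r : ℝ}
    (h : RealStepRate P μ ν c θ) (hB : StripBound P μ ν R M)
    (hE : ∀ k, ∀ v ∈ ({Pi.single μ 1, Pi.single ν 1, Pi.single μ 1 + Pi.single ν 1} : Set (Fin d → ℤ)),
      ExpMoment (P k μ ν) v R)
    (hR : 0 < R) (hrR : r ≤ R) (hc : 0 < c) (hθ0 : 0 < θ) (hθ1 : θ ≤ 1) (hcM : c ≤ 2 * M) :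
    StripStepRate P μ ν r (c ^ (1 - r / R) * (2 * M) ^ (r / R)) (θ ^ (1 - r / R)) := by
  intro k v hv z hz
  have hεk : 0 < c * θ ^ k := mul_pos hc (pow_pos hθ0 k)
  have hεM : c * θ ^ k ≤ 2 * M := (mul_le_of_le_one_right hc.le (pow_le_one₀ hθ0.le hθ1)).trans hcM
  have hMst : ∀ w : ℂ, |w.im| ≤ R →
      ‖dirSymbolC (P (k + 1) μ ν) v w - dirSymbolC (P k μ ν) v w‖ ≤ 2 * M := by
    intro w hw
    calc ‖dirSymbolC (P (k + 1) μ ν) v w - dirSymbolC (P k μ ν) v w‖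
        ≤ ‖dirSymbolC (P (k + 1) μ ν) v w‖ + ‖dirSymbolC (P k μ ν) v w‖ := norm_sub_le _ _
      _ ≤ M + M := add_le_add (hB (k + 1) v hv w hw) (hB k v hv w hw)
      _ = 2 * M := by ring
  have key := MomentSymbol.norm_dirSymbolC_sub_le_of_real (hE (k + 1) v hv) (hE k v hv) hR hrR hεk hεM
    (h k v hv) hMst hz
  rw [MomentSymbol.rpow_rate c θ (1 - r / R) hc.le hθ0.le k] at key
  calc ‖dirSymbolC (P (k + 1) μ ν) v z - dirSymbolC (P k μ ν) v z‖
      ≤ c ^ (1 - r / R) * (θ ^ (1 - r / R)) ^ k * (2 * M) ^ (r / R) := key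
    _ = c ^ (1 - r / R) * (2 * M) ^ (r / R) * (θ ^ (1 - r / R)) ^ k := by ring

/-- The transported ratio `θ^{1−r/R}` is again in `[0, 1[` for `r < R`. [folklore] -/
theorem ratio_lt_one {θ R r : ℝ} (hθ0 : 0 ≤ θ) (hθ1 : θ < 1) (hR : 0 < R) (hrR : r < R) :
    0 ≤ θ ^ (1 - r / R) ∧ θ ^ (1 - r / R) < 1 :=
  ⟨Real.rpow_nonneg hθ0 _, Real.rpow_lt_one hθ0 hθ1 (by rw [sub_pos, div_lt_one hR]; exact hrR)⟩

/-- **B12 Theorem 2 AS PRINTED from a REAL step rate** + the uniform strip bound + the one-sided certified list + the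
gap at the transported constants (momentum route, three lines, Cauchy, margin form §7): with
`c' = c^{1−r/R}(2M)^{r/R}`, `θ' = θ^{1−r/R}` the cap budget reads `c₀ = 3c'/(r²(1−θ'))`.
[cite: Balaban1987RG1, RG equations (0.17)–(0.20) p.255; Thm 2 p.259 with (0.31)] -/
theorem thm2Printed_of_realMargin {β : (k : ℕ) → (Fin (k + 1) → ℝ) → ℝ} {C : B12.Construction}
    (hgen : ForwardGenerated C β) {L : ℝ} (hL : 1 < L) (S : B12Beta.OneLoopSplit β) {P : ℕ → B12Beta.Kernel d}
    {μ ν : Fin d} (hP : ∀ k, PolarizationSign.MomentSummable (P k) 2)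
    (hβ0 : ∀ k, S.β0 k = B12Beta.secondMoment (P k) μ ν) {γ₀ R r c θ M Cr β' m : ℝ} {k₁ : ℕ} (hγ₀ : 0 < γ₀)
    (hR : 0 < R) (hr : 0 < r) (hrR : r < R) (hc : 0 < c) (hθ0 : 0 < θ) (hθ1 : θ < 1)
    (hrate : RealStepRate P μ ν c θ) (hB : StripBound P μ ν R M) (hcM : c ≤ 2 * M)
    (hE : ∀ k, ∀ v ∈ ({Pi.single μ 1, Pi.single ν 1, Pi.single μ 1 + Pi.single ν 1} : Set (Fin d → ℤ)),
      ExpMoment (P k μ ν) v R)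
    (hlist : ∀ k, k ≤ k₁ → m ≤ S.β0 k)
    (hgap : 3 * (c ^ (1 - r / R) * (2 * M) ^ (r / R)) / r ^ 2 / (1 - θ ^ (1 - r / R))
      * (θ ^ (1 - r / R)) ^ k₁ * (1 + θ ^ (1 - r / R)) < m)
    (hCr : 0 ≤ Cr)
    (haf1 : ∀ k (p : Fin (k + 1) → ℝ), p ∈ B12Beta.HistBox γ₀ k → |S.β1 k p| ≤ Cr * p (Fin.last k))
    (hcont : BetaContH γ₀ β) (hup : BetaUpperH β' γ₀ β) : B12.Thm2Printed C L :=
  have hθ' := ratio_lt_one hθ0.le hθ1 hR hrR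
  thm2Printed_of_stripMargin hgen hL S hP hβ0 hγ₀ hr hθ'.1 hθ'.2
    (hrate.stripStepRate hB hE hR hrR.le hc hθ0 hθ1.le hcM) (fun k v hv => (hE k v hv).mono hrR.le)
    hlist hgap hCr haf1 hcont hup

/-- **Positivity of every `β⁰_{k+1}` from a REAL step rate**, the strip bound, the list and the gap. [folklore] -/
theorem beta0_pos_all_of_realMargin {β : (k : ℕ) → (Fin (k + 1) → ℝ) → ℝ} (S : B12Beta.OneLoopSplit β)
    {P : ℕ → B12Beta.Kernel d} {μ ν : Fin d} (hP : ∀ k, PolarizationSign.MomentSummable (P k) 2)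
    (hβ0 : ∀ k, S.β0 k = B12Beta.secondMoment (P k) μ ν) {R r c θ M m : ℝ} {k₁ : ℕ}
    (hR : 0 < R) (hr : 0 < r) (hrR : r < R) (hc : 0 < c) (hθ0 : 0 < θ) (hθ1 : θ < 1)
    (hrate : RealStepRate P μ ν c θ) (hB : StripBound P μ ν R M) (hcM : c ≤ 2 * M)
    (hE : ∀ k, ∀ v ∈ ({Pi.single μ 1, Pi.single ν 1, Pi.single μ 1 + Pi.single ν 1} : Set (Fin d → ℤ)),
      ExpMoment (P k μ ν) v R)
    (hlist : ∀ k, k ≤ k₁ → m ≤ S.β0 k)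
    (hgap : 3 * (c ^ (1 - r / R) * (2 * M) ^ (r / R)) / r ^ 2 / (1 - θ ^ (1 - r / R))
      * (θ ^ (1 - r / R)) ^ k₁ * (1 + θ ^ (1 - r / R)) < m) :
    ∀ k, 0 < S.β0 k :=
  have hθ' := ratio_lt_one hθ0.le hθ1 hR hrR
  beta0_pos_all_of_stripMargin S hP hβ0 hr hθ'.1 hθ'.2
    (hrate.stripStepRate hB hE hR hrR.le hc hθ0 hθ1.le hcM) (fun k v hv => (hE k v hv).mono hrR.le) hlist hgap

/-- **All-in-one from the printed decay**: with (5.10) constants `(C, δ₁)` uniform in `k`, `μ ≠ ν`, radius `R < δ₁`,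
the strip bound and the exponential moments are discharged; what remains OPEN is the real step rate (and the list, the
gap, the remainder data). [cite: Balaban1987RG1, (5.10) p.293; RG equations (0.17)–(0.20) p.255; Thm 2 p.259 with (0.31)] -/
theorem beta0_pos_all_of_realMargin_decay {β : (k : ℕ) → (Fin (k + 1) → ℝ) → ℝ} (S : B12Beta.OneLoopSplit β)
    {P : ℕ → B12Beta.Kernel d} {μ ν : Fin d} (hne : μ ≠ ν) (hP : ∀ k, PolarizationSign.MomentSummable (P k) 2)
    (hβ0 : ∀ k, S.β0 k = B12Beta.secondMoment (P k) μ ν) {C δ₁ R r c θ m : ℝ} {k₁ : ℕ}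
    (hdec : ∀ k, B12Sec2to5.Decay510 (P k μ ν) C δ₁) (hR : 0 < R) (hRδ : R < δ₁) (hr : 0 < r) (hrR : r < R)
    (hc : 0 < c) (hθ0 : 0 < θ) (hθ1 : θ < 1) (hrate : RealStepRate P μ ν c θ)
    (hcM : c ≤ 2 * (C * ∑' x : Fin d → ℤ, Real.exp (-(δ₁ - R) * B12Sec2to5.l1 x)))
    (hlist : ∀ k, k ≤ k₁ → m ≤ S.β0 k)
    (hgap : 3 * (c ^ (1 - r / R) * (2 * (C * ∑' x : Fin d → ℤ, Real.exp (-(δ₁ - R) * B12Sec2to5.l1 x)))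
      ^ (r / R)) / r ^ 2 / (1 - θ ^ (1 - r / R)) * (θ ^ (1 - r / R)) ^ k₁ * (1 + θ ^ (1 - r / R)) < m) :
    ∀ k, 0 < S.β0 k :=
  beta0_pos_all_of_realMargin S hP hβ0 hR hr hrR hc hθ0 hθ1 hrate (stripBound_of_decay510 hne hdec hR.le hRδ)
    hcM (expMoments_of_decay510 hne hdec hR.le hRδ) hlist hgap

end RealSocket

/-! ## 10. BLOCK TRANSFER (v1.6): `n` steps of block size `L` versus one step of block size `L^n` — SEQUENCE ALGEBRA ONLY.
Nothing in this section is specific to Bałaban's kernels.  The END statements carry the hypothesis `hblock : ∀ k, S.β0 k =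
blockSum n b k` — the located one-loop COMPOSITION QUESTION Q-asym1-5 (journal l.47635: do the one-loop coefficients of the
construction at block size `L^n` equal the block sums of those at block size `L`?  By Fubini the `n`-fold iterate of the
sharp-constraint `L`-step is one `L^n`-step with the COMPOSED average, and B12's averaging axioms (0.5)–(0.9), p.253, make
composition exact to second order around `U = 1`; whether the higher-order discrepancy enters `β⁰` is OPEN).  It is a
HYPOTHESIS binder, never asserted.  Intended use: `L = 3 ↦ L^3 = 27` — certified one-loop values are only available at
`L ∈ {2, 3, 4}` (journal l.47332) while Theorem 2 is printed for block size «L odd > 11» (B12 p.251).  CAVEAT (v1.6.1,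
memo HOME/BETA/ASYM-beta.md §4″): B12's `L` is the block size of ONE renormalization transformation (0.13)/(0.16)–(0.19)
and fixes the whole scale ladder `T_ε^{(k)}`, `ε = L^{−K}` (p.251, p.254–255).  Three block-size-`L^n` schemes must be
distinguished: (S1) the `L`-chain re-indexed in blocks of `n` steps (its one-step one-loop coefficients ARE the block sums,
by the one-loop telescoping of (0.18)/(0.20) — but its steps have block size `L`, outside the printed regime when `L ≤ 11`);
(S2) ONE transformation (0.13) whose kernel constrains `V` to the `n`-fold COMPOSED average (EXPECTED to have the block
sums as one-loop coefficients — formally: Fubini for the constraint kernels, the gauge fixing (0.15) is an identity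
insertion, small-field characteristic functions are invisible to every perturbative order — but B12 DEFINES `β_k` by an
extraction from the `k`-th step expansion (Sect. 1, (1.19)–(1.22)) and commuting that extraction with composition is exactly
Q-asym1-5; covered by Theorem 2 only if the estimates of B4–B12 hold for the composed average — «we may use many other
definitions», p.254, is a remark, not a printed theorem); (S3) the GENUINE single step with the
average (0.4)/(0.12) at block size `L^n` (inside the printed regime; its finite-`k` one-loop coefficients MAY differ from
the block sums — the composed and the direct average agree to second order around `U = 1` (memo §4″ (ii)) and whether the
higher-order discrepancy enters `β⁰` is Q-asym1-5 (iii); if they differ, the difference is a one-loop SCHEME TRANSFER and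
the honest hypothesis is a transfer RATE — the nearness `NearRate` of §11 (v1.7), of which `hblock` is the case `e = 0`).
`hblock` as an EQUALITY is a statement about (S1)/(S2), and about (S3) exactly if Q-asym1-5 (iii) has the answer YES. -/
section BlockTransfer

open Finset in
/-- Block sums of a real sequence: `blockSum n b k = Σ_{i<n} b (n·k + i)`. [folklore] -/
def blockSum (n : ℕ) (b : ℕ → ℝ) (k : ℕ) : ℝ := ∑ i ∈ range n, b (n * k + i)

open Finset in
/-- Consecutive block sums differ by the sum of the `n`-step differences. [folklore] -/
theorem blockSum_succ_sub (n : ℕ) (b : ℕ → ℝ) (k : ℕ) :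
    blockSum n b (k + 1) - blockSum n b k = ∑ i ∈ range n, (b (n * k + i + n) - b (n * k + i)) := by
  simp only [blockSum, ← Finset.sum_sub_distrib]
  refine Finset.sum_congr rfl fun i _ => ?_
  congr 2; ring

open Finset in
/-- Telescoping: a `CauchyRate` bounds `|b (j + n) − b j|` by `Σ_{l<n} c·θ^{j+l}`. [folklore] -/
theorem CauchyRate.abs_sub_le_sum {b : ℕ → ℝ} {c θ : ℝ} (h : CauchyRate b c θ) (j n : ℕ) :
    |b (j + n) - b j| ≤ ∑ l ∈ range n, c * θ ^ (j + l) := by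
  induction n with
  | zero => simp
  | succ n ih =>
    calc |b (j + (n + 1)) - b j| = |(b (j + n + 1) - b (j + n)) + (b (j + n) - b j)| := by ring_nf
      _ ≤ |b (j + n + 1) - b (j + n)| + |b (j + n) - b j| := abs_add_le _ _
      _ ≤ c * θ ^ (j + n) + ∑ l ∈ range n, c * θ ^ (j + l) := add_le_add (h (j + n)) ih
      _ = ∑ l ∈ range (n + 1), c * θ ^ (j + l) := by rw [Finset.sum_range_succ, add_comm]

open Finset in
/-- **`CauchyRate` passes to block sums**: ratio `θ^n`, constant `c·(Σ_{i<n} θ^i)²`. [folklore] -/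
theorem cauchyRate_blockSum {b : ℕ → ℝ} {c θ : ℝ} (h : CauchyRate b c θ) (n : ℕ) :
    CauchyRate (blockSum n b) (c * (∑ i ∈ range n, θ ^ i) ^ 2) (θ ^ n) := by
  intro k
  rw [blockSum_succ_sub]
  calc |∑ i ∈ range n, (b (n * k + i + n) - b (n * k + i))|
      ≤ ∑ i ∈ range n, |b (n * k + i + n) - b (n * k + i)| := Finset.abs_sum_le_sum_abs _ _
    _ ≤ ∑ i ∈ range n, ∑ l ∈ range n, c * θ ^ (n * k + i + l) :=
        Finset.sum_le_sum fun i _ => h.abs_sub_le_sum (n * k + i) n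
    _ = c * (∑ i ∈ range n, θ ^ i) ^ 2 * (θ ^ n) ^ k := by
        rw [sq, ← pow_mul, Finset.sum_mul_sum, Finset.mul_sum, Finset.sum_mul]
        refine Finset.sum_congr rfl fun i _ => ?_
        rw [Finset.mul_sum, Finset.sum_mul]
        refine Finset.sum_congr rfl fun l _ => ?_
        rw [show n * k + i + l = i + l + n * k by ring, pow_add, pow_add]; ring

open Finset in
/-- **`GeomRate` passes to block sums**: limit `n·b_∞`, ratio `θ^n`, constant `c₀·Σ_{i<n} θ^i`. [folklore] -/
theorem geomRate_blockSum {b : ℕ → ℝ} {binf c₀ θ : ℝ} (h : GeomRate b binf c₀ θ) (n : ℕ) :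
    GeomRate (blockSum n b) ((n : ℝ) * binf) (c₀ * ∑ i ∈ range n, θ ^ i) (θ ^ n) := by
  intro k
  have hrw : blockSum n b k - (n : ℝ) * binf = ∑ i ∈ range n, (b (n * k + i) - binf) := by
    rw [Finset.sum_sub_distrib, blockSum]; simp
  rw [hrw]
  calc |∑ i ∈ range n, (b (n * k + i) - binf)| ≤ ∑ i ∈ range n, |b (n * k + i) - binf| :=
        Finset.abs_sum_le_sum_abs _ _
    _ ≤ ∑ i ∈ range n, c₀ * θ ^ (n * k + i) := Finset.sum_le_sum fun i _ => h (n * k + i)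
    _ = c₀ * (∑ i ∈ range n, θ ^ i) * (θ ^ n) ^ k := by
        rw [← pow_mul, Finset.mul_sum, Finset.sum_mul]
        refine Finset.sum_congr rfl fun i _ => ?_
        rw [show n * k + i = i + n * k by ring, pow_add]; ring

open Finset in
/-- **END STATEMENT (block-transfer margin form).**  A construction `C` (block size `L'`, think `L' = L^n`) with one-loop
split `S`; a small-block sequence `b` (think `b k = β⁰_{k+1}` at block size `L`) with a `CauchyRate` (from any of the
sockets §6/§8/§9 at the SMALL block size: `SymbolStepRate.cauchyRate`, `StripStepRate.cauchyRate`,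
`RealStepRate.stripStepRate`); the COMPOSITION HYPOTHESIS `hblock` (Q-asym1-5, located, NOT printed, NOT asserted);
one-sided certified lower values `m ≤ Σ_{i<n} b (n k + i)` for `k ≤ k₁` (small-block certified numerics); the gap; and the
(AF-1)/(C)/(U) sockets for `C`'s flow function.  [cite: Balaban1987RG1, RG equations (0.17)–(0.20) p.255; Thm 2 p.259 with (0.31); (1.22) p.264] -/
theorem thm2Printed_of_blockMargin {β : (k : ℕ) → (Fin (k + 1) → ℝ) → ℝ} {C : B12.Construction}
    (hgen : ForwardGenerated C β) {L' : ℝ} (hL : 1 < L')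
    (S : B12Beta.OneLoopSplit β) {b : ℕ → ℝ} {n : ℕ} (hn : 0 < n) (hblock : ∀ k, S.β0 k = blockSum n b k)
    {γ₀ c θ Cr β' m : ℝ} {k₁ : ℕ} (hγ₀ : 0 < γ₀) (hθ0 : 0 ≤ θ) (hθ1 : θ < 1) (hrate : CauchyRate b c θ)
    (hlist : ∀ k, k ≤ k₁ → m ≤ blockSum n b k)
    (hgap : c * (∑ i ∈ range n, θ ^ i) ^ 2 / (1 - θ ^ n) * (θ ^ n) ^ k₁ * (1 + θ ^ n) < m) (hCr : 0 ≤ Cr)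
    (haf1 : ∀ k (p : Fin (k + 1) → ℝ), p ∈ B12Beta.HistBox γ₀ k → |S.β1 k p| ≤ Cr * p (Fin.last k))
    (hcont : BetaContH γ₀ β) (hup : BetaUpperH β' γ₀ β) : B12.Thm2Printed C L' := by
  have hrate' : CauchyRate S.β0 (c * (∑ i ∈ range n, θ ^ i) ^ 2) (θ ^ n) := by
    intro k; rw [hblock, hblock]; exact cauchyRate_blockSum hrate n k
  have hlist' : ∀ k, k ≤ k₁ → m ≤ S.β0 k := fun k hk => (hblock k).symm ▸ hlist k hk
  exact thm2Printed_of_cauchyMargin hgen hL S hγ₀ (pow_nonneg hθ0 n) (pow_lt_one₀ hθ0 hθ1 hn.ne') hrate' hlist'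
    hgap hCr haf1 hcont hup

open Finset in
/-- **Positivity of every one-loop coefficient at the large block size** from the small-block rate, the composition
hypothesis, the small-block one-sided list and the gap. [folklore] -/
theorem beta0_pos_all_of_blockMargin {β : (k : ℕ) → (Fin (k + 1) → ℝ) → ℝ} (S : B12Beta.OneLoopSplit β) {b : ℕ → ℝ}
    {n : ℕ} (hn : 0 < n) (hblock : ∀ k, S.β0 k = blockSum n b k) {c θ m : ℝ} {k₁ : ℕ} (hθ0 : 0 ≤ θ) (hθ1 : θ < 1)
    (hrate : CauchyRate b c θ) (hlist : ∀ k, k ≤ k₁ → m ≤ blockSum n b k)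
    (hgap : c * (∑ i ∈ range n, θ ^ i) ^ 2 / (1 - θ ^ n) * (θ ^ n) ^ k₁ * (1 + θ ^ n) < m) : ∀ k, 0 < S.β0 k := by
  have hrate' : CauchyRate S.β0 (c * (∑ i ∈ range n, θ ^ i) ^ 2) (θ ^ n) := by
    intro k; rw [hblock, hblock]; exact cauchyRate_blockSum hrate n k
  have hlist' : ∀ k, k ≤ k₁ → m ≤ S.β0 k := fun k hk => (hblock k).symm ▸ hlist k hk
  have hθ1' : θ ^ n < 1 := pow_lt_one₀ hθ0 hθ1 hn.ne'
  exact beta0_pos_all_of_margin S (pow_nonneg hθ0 n) hθ1'.le (hrate'.geomRate hθ1') hlist' hgap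

namespace Witness

/-- Non-vacuity of the block-transfer hypotheses: the constant small-block sequence `b ≡ 1`, `n = 3`, block sums `≡ 3`.
[folklore] -/
theorem blockMargin_nonvacuous :
    ∃ (b : ℕ → ℝ) (n : ℕ) (c θ m : ℝ) (k₁ : ℕ), 0 < n ∧ 0 ≤ θ ∧ θ < 1 ∧ CauchyRate b c θ ∧
      (∀ k, k ≤ k₁ → m ≤ blockSum n b k) ∧
      c * (∑ i ∈ Finset.range n, θ ^ i) ^ 2 / (1 - θ ^ n) * (θ ^ n) ^ k₁ * (1 + θ ^ n) < m := by
  refine ⟨fun _ => 1, 3, 0, 1 / 2, 3, 0, by norm_num, by norm_num, by norm_num, ?_, ?_, by norm_num⟩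
  · intro k; simp
  · intro k _; simp [blockSum]

end Witness

end BlockTransfer

/-! ## 11. NEAR-SEQUENCE TRANSFER (v1.7): the INEQUALITY form of the composition hypothesis — SEQUENCE ALGEBRA ONLY.
§10 compares the one-loop coefficients `S.β0` of a construction with a COMPARISON sequence `a` (there: the block sums of
a small-block sequence) through an EQUALITY `hblock`.  For the genuine single B12 step of block size `L^n` (scheme (S3)
of the §10 caveat) an equality is not to be expected at finite `k`; the honest shape is a RATE OF NEARNESS
`NearRate a S.β0 e ϑ : ∀ k, |S.β0 k − a k| ≤ e·ϑ^k` — a one-loop SCHEME-TRANSFER statement with explicit `(e, ϑ)`,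
LOCATED with Q-asym1-5 (journal l.47635; memo HOME/BETA/ASYM-beta.md §4″), NOT printed, NEVER asserted here.  This
section is the algebra that consumes it: a `GeomRate` / `CauchyRate` and a one-sided certified list TRANSFER along a
`NearRate` at the cost `c₀ ↦ c₀ + e`, `m ↦ m − e`; with `e = 0` it is §10's `hblock`.  Nothing here is specific to
Bałaban's kernels. -/
section NearTransfer

/-- HYPOTHESIS SHAPE: two real sequences are `(e, ϑ)`-NEAR, `|b k − a k| ≤ e·ϑ^k` for all `k`.  For `a` = block sums of
small-block one-loop coefficients and `b = S.β0` of the genuine block-size-`L^n` step this is the located one-loop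
scheme-transfer question (Q-asym1-5, inequality form); NOT printed. [cite: Balaban1987RG1, (1.22) p.264] -/
def NearRate (a b : ℕ → ℝ) (e ϑ : ℝ) : Prop :=
  ∀ k, |b k - a k| ≤ e * ϑ ^ k

namespace NearRate

variable {a b : ℕ → ℝ} {e ϑ : ℝ}

/-- The constant of a `NearRate` is `≥ 0` (take `k = 0`). [folklore] -/
theorem const_nonneg (h : NearRate a b e ϑ) : 0 ≤ e := by
  simpa using (abs_nonneg _).trans (h 0)

/-- An equality of sequences is a `NearRate` with constant `0` (§10's `hblock` is the case `e = 0`). [folklore] -/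
theorem of_eq (h : ∀ k, b k = a k) (ϑ : ℝ) : NearRate a b 0 ϑ := by
  intro k; simp [h k]

/-- Symmetry. [folklore] -/
theorem symm (h : NearRate a b e ϑ) : NearRate b a e ϑ := by
  intro k; rw [abs_sub_comm]; exact h k

/-- Pointwise consequence for `0 ≤ ϑ ≤ 1`: `a k − e ≤ b k`. [folklore] -/
theorem sub_le (h : NearRate a b e ϑ) (hϑ0 : 0 ≤ ϑ) (hϑ1 : ϑ ≤ 1) (k : ℕ) : a k - e ≤ b k := by
  have h1 := h k
  have h2 : e * ϑ ^ k ≤ e := by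
    simpa using mul_le_mul_of_nonneg_left (pow_le_one₀ hϑ0 hϑ1 : ϑ ^ k ≤ 1) h.const_nonneg
  have h3 := (abs_le.mp (h1.trans h2)).1
  linarith

/-- **A `GeomRate` transfers along a `NearRate` with the same ratio: `c₀ ↦ c₀ + e`, same limit.** [folklore] -/
theorem geomRate (h : NearRate a b e ϑ) {binf c₀ : ℝ} (ha : GeomRate a binf c₀ ϑ) : GeomRate b binf (c₀ + e) ϑ := by
  intro k
  have h1 := h k; have h2 := ha k
  calc |b k - binf| = |(b k - a k) + (a k - binf)| := by ring_nf
    _ ≤ |b k - a k| + |a k - binf| := abs_add_le _ _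
    _ ≤ e * ϑ ^ k + c₀ * ϑ ^ k := add_le_add h1 h2
    _ = (c₀ + e) * ϑ ^ k := by ring

/-- **A `CauchyRate` transfers along a `NearRate` with the same ratio: `c ↦ c + e(1+ϑ)`.** [folklore] -/
theorem cauchyRate (h : NearRate a b e ϑ) {c : ℝ} (ha : CauchyRate a c ϑ) :
    CauchyRate b (c + e * (1 + ϑ)) ϑ := by
  intro k
  have h0 := h k; have h1 := h (k + 1); have h2 := ha k
  calc |b (k + 1) - b k| = |(b (k + 1) - a (k + 1)) + (a (k + 1) - a k) - (b k - a k)| := by ring_nf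
    _ ≤ |(b (k + 1) - a (k + 1)) + (a (k + 1) - a k)| + |b k - a k| := abs_sub _ _
    _ ≤ (|b (k + 1) - a (k + 1)| + |a (k + 1) - a k|) + |b k - a k| :=
        add_le_add (abs_add_le _ _) le_rfl
    _ ≤ (e * ϑ ^ (k + 1) + c * ϑ ^ k) + e * ϑ ^ k := add_le_add (add_le_add h1 h2) h0
    _ = (c + e * (1 + ϑ)) * ϑ ^ k := by ring

/-- **A one-sided certified list transfers along a `NearRate`: `m ↦ m − e`.** [folklore] -/
theorem list (h : NearRate a b e ϑ) (hϑ0 : 0 ≤ ϑ) (hϑ1 : ϑ ≤ 1) {m : ℝ} {k₁ : ℕ}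
    (hlist : ∀ k, k ≤ k₁ → m ≤ a k) : ∀ k, k ≤ k₁ → m - e ≤ b k := fun k hk =>
  le_trans (by linarith [hlist k hk]) (h.sub_le hϑ0 hϑ1 k)

/-- Weakening of the constants. [folklore] -/
theorem mono (h : NearRate a b e ϑ) {e' ϑ' : ℝ} (he : e ≤ e') (hϑ0 : 0 ≤ ϑ) (hϑ : ϑ ≤ ϑ') : NearRate a b e' ϑ' :=
  fun k => (h k).trans (mul_le_mul he (pow_le_pow_left₀ hϑ0 hϑ k) (pow_nonneg hϑ0 k) (h.const_nonneg.trans he))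

end NearRate

/-- **B12 Theorem 2 AS PRINTED through a NEAR-SEQUENCE TRANSFER (margin form §7)**: a `GeomRate` for a COMPARISON
sequence `a` (any road: §3–§10), the located nearness `NearRate a S.β0 e θ` (one-loop scheme transfer; OPEN, never
asserted), one-sided certified lower values `m ≤ a k` for `k ≤ k₁`, and the gap at the transferred constants
`(c₀ + e)·θ^{k₁}(1+θ) < m − e`. [cite: Balaban1987RG1, RG equations (0.17)–(0.20) p.255; Thm 2 p.259 with (0.31)] -/
theorem thm2Printed_of_nearMargin {β : (k : ℕ) → (Fin (k + 1) → ℝ) → ℝ} {C : B12.Construction}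
    (hgen : ForwardGenerated C β) {L : ℝ} (hL : 1 < L) (S : B12Beta.OneLoopSplit β) {a : ℕ → ℝ}
    {γ₀ binf c₀ θ e Cr β' m : ℝ} {k₁ : ℕ} (hγ₀ : 0 < γ₀) (hθ0 : 0 ≤ θ) (hθ1 : θ ≤ 1)
    (hconv : GeomRate a binf c₀ θ) (hnear : NearRate a S.β0 e θ) (hlist : ∀ k, k ≤ k₁ → m ≤ a k)
    (hgap : (c₀ + e) * θ ^ k₁ * (1 + θ) < m - e) (hCr : 0 ≤ Cr)
    (haf1 : ∀ k (p : Fin (k + 1) → ℝ), p ∈ B12Beta.HistBox γ₀ k → |S.β1 k p| ≤ Cr * p (Fin.last k))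
    (hcont : BetaContH γ₀ β) (hup : BetaUpperH β' γ₀ β) : B12.Thm2Printed C L :=
  thm2Printed_of_margin hgen hL S hγ₀ hθ0 hθ1 (hnear.geomRate hconv) (hnear.list hθ0 hθ1 hlist) hgap hCr haf1
    hcont hup

/-- **Positivity of every one-loop coefficient through a near-sequence transfer** (rate of the comparison sequence,
nearness, list, gap; no (AF-1)/(C)/(U), no DAG). [folklore] -/
theorem beta0_pos_all_of_nearMargin {β : (k : ℕ) → (Fin (k + 1) → ℝ) → ℝ} (S : B12Beta.OneLoopSplit β)
    {a : ℕ → ℝ} {binf c₀ θ e m : ℝ} {k₁ : ℕ} (hθ0 : 0 ≤ θ) (hθ1 : θ ≤ 1) (hconv : GeomRate a binf c₀ θ)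
    (hnear : NearRate a S.β0 e θ) (hlist : ∀ k, k ≤ k₁ → m ≤ a k) (hgap : (c₀ + e) * θ ^ k₁ * (1 + θ) < m - e) :
    ∀ k, 0 < S.β0 k :=
  beta0_pos_all_of_margin S hθ0 hθ1 (hnear.geomRate hconv) (hnear.list hθ0 hθ1 hlist) hgap

open Finset in
/-- **B12 Theorem 2 AS PRINTED for the GENUINE block-size-`L^n` step from SMALL-BLOCK data** (§10 with the equality
`hblock` replaced by the located nearness): a small-block `CauchyRate b c θ`, the nearness of `S.β0` to the block sums
with ratio `θ^n` and constant `e` (one-loop scheme transfer (S3) ↔ (S1), OPEN), one-sided certified lower values of the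
block sums for `k ≤ k₁`, and the gap at `c₀ = c(Σ_{i<n}θ^i)²/(1−θ^n) + e`, margin `m − e`.
[cite: Balaban1987RG1, RG equations (0.17)–(0.20) p.255; Thm 2 p.259 with (0.31); (1.22) p.264] -/
theorem thm2Printed_of_blockNearMargin {β : (k : ℕ) → (Fin (k + 1) → ℝ) → ℝ} {C : B12.Construction}
    (hgen : ForwardGenerated C β) {L' : ℝ} (hL : 1 < L') (S : B12Beta.OneLoopSplit β) {b : ℕ → ℝ} {n : ℕ}
    (hn : 0 < n) {γ₀ c θ e Cr β' m : ℝ} {k₁ : ℕ} (hγ₀ : 0 < γ₀) (hθ0 : 0 ≤ θ) (hθ1 : θ < 1)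
    (hrate : CauchyRate b c θ) (hnear : NearRate (blockSum n b) S.β0 e (θ ^ n))
    (hlist : ∀ k, k ≤ k₁ → m ≤ blockSum n b k)
    (hgap : (c * (∑ i ∈ range n, θ ^ i) ^ 2 / (1 - θ ^ n) + e) * (θ ^ n) ^ k₁ * (1 + θ ^ n) < m - e)
    (hCr : 0 ≤ Cr)
    (haf1 : ∀ k (p : Fin (k + 1) → ℝ), p ∈ B12Beta.HistBox γ₀ k → |S.β1 k p| ≤ Cr * p (Fin.last k))
    (hcont : BetaContH γ₀ β) (hup : BetaUpperH β' γ₀ β) : B12.Thm2Printed C L' := by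
  have hθn0 : 0 ≤ θ ^ n := pow_nonneg hθ0 n
  have hθn1 : θ ^ n < 1 := pow_lt_one₀ hθ0 hθ1 hn.ne'
  exact thm2Printed_of_nearMargin hgen hL S hγ₀ hθn0 hθn1.le ((cauchyRate_blockSum hrate n).geomRate hθn1) hnear
    hlist hgap hCr haf1 hcont hup

open Finset in
/-- **Positivity of every one-loop coefficient of the genuine block-size-`L^n` step** from small-block rate, nearness,
small-block list and gap. [folklore] -/
theorem beta0_pos_all_of_blockNearMargin {β : (k : ℕ) → (Fin (k + 1) → ℝ) → ℝ} (S : B12Beta.OneLoopSplit β)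
    {b : ℕ → ℝ} {n : ℕ} (hn : 0 < n) {c θ e m : ℝ} {k₁ : ℕ} (hθ0 : 0 ≤ θ) (hθ1 : θ < 1) (hrate : CauchyRate b c θ)
    (hnear : NearRate (blockSum n b) S.β0 e (θ ^ n)) (hlist : ∀ k, k ≤ k₁ → m ≤ blockSum n b k)
    (hgap : (c * (∑ i ∈ range n, θ ^ i) ^ 2 / (1 - θ ^ n) + e) * (θ ^ n) ^ k₁ * (1 + θ ^ n) < m - e) :
    ∀ k, 0 < S.β0 k := by
  have hθn0 : 0 ≤ θ ^ n := pow_nonneg hθ0 n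
  have hθn1 : θ ^ n < 1 := pow_lt_one₀ hθ0 hθ1 hn.ne'
  exact beta0_pos_all_of_nearMargin S hθn0 hθn1.le ((cauchyRate_blockSum hrate n).geomRate hθn1) hnear hlist hgap

/-- §10's equality road is the case `e = 0` of the near road (consistency check). [folklore] -/
theorem beta0_pos_all_of_blockMargin' {β : (k : ℕ) → (Fin (k + 1) → ℝ) → ℝ} (S : B12Beta.OneLoopSplit β)
    {b : ℕ → ℝ} {n : ℕ} (hn : 0 < n) (hblock : ∀ k, S.β0 k = blockSum n b k) {c θ m : ℝ} {k₁ : ℕ} (hθ0 : 0 ≤ θ)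
    (hθ1 : θ < 1) (hrate : CauchyRate b c θ) (hlist : ∀ k, k ≤ k₁ → m ≤ blockSum n b k)
    (hgap : c * (∑ i ∈ Finset.range n, θ ^ i) ^ 2 / (1 - θ ^ n) * (θ ^ n) ^ k₁ * (1 + θ ^ n) < m) :
    ∀ k, 0 < S.β0 k :=
  beta0_pos_all_of_blockNearMargin S hn hθ0 hθ1 hrate (NearRate.of_eq hblock _) hlist (by simpa using hgap)

namespace Witness

/-- Non-vacuity of the near-transfer hypotheses: `a ≡ 1` (`GeomRate a 1 0 (1/2)`), `b k = 1 + (1/4)(1/2)^k`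
(`NearRate a b (1/4) (1/2)`), list `m = 1`, `k₁ = 0`: gap `(0 + 1/4)·1·(3/2) = 3/8 < 3/4`. [folklore] -/
theorem nearMargin_nonvacuous :
    ∃ (a b : ℕ → ℝ) (binf c₀ θ e m : ℝ) (k₁ : ℕ), 0 ≤ θ ∧ θ ≤ 1 ∧ GeomRate a binf c₀ θ ∧ NearRate a b e θ ∧
      (∀ k, k ≤ k₁ → m ≤ a k) ∧ (c₀ + e) * θ ^ k₁ * (1 + θ) < m - e := by
  refine ⟨fun _ => 1, fun k => 1 + 1 / 4 * (1 / 2) ^ k, 1, 0, 1 / 2, 1 / 4, 1, 0, by norm_num, by norm_num,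
    ?_, ?_, ?_, by norm_num⟩
  · intro k; simp
  · intro k; simp
  · intro k _; simp

end Witness

end NearTransfer

/-! ## 12. EVENTUAL RATES (v1.8): the rate hypothesis FROM A THRESHOLD SCALE `k₁` ON — the first-step exemption.
SEQUENCE ALGEBRA ONLY.  The margin form (§7) invokes the rate `|b_k − b_∞| ≤ c₀θ^k` only at the scales the certified
lane does NOT cover: `GeomRate.tail_ge_margin` uses the certificate at `k₁`, `binf_ge` AT `k₁` and the rate at
`k ≥ k₁ + 1`; at the certified depths `k < k₁` the rate is never used.  So the (asym) input §7 really consumes is the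
EVENTUAL shape `EvGeomRate b b_∞ c₀ θ k₁ : ∀ k ≥ k₁, |b_k − b_∞| ≤ c₀θ^k` (Cauchy form `EvCauchyRate b c θ k₁ :
∀ k ≥ k₁, |b_{k+1} − b_k| ≤ cθ^k`; momentum form `EvSymbolStepRate P μ ν c θ k₁`), whose constant is fitted to the TAIL
and not to the first steps.  MOTIVATION (cell EVIDENCE, float grade, never a certificate and never used below: memo
HOME/BETA/ASYM-beta.md §3.7 (d), beta-num ENGINE-C rows NUM-C3 §Y): along Bałaban's sequence the FIRST step — taken from
the Wilson action, before any averaging operation has acted — moves the one-loop coefficient far more than any later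
step (SU(2), `L = 2`: `β⁰₁ ≈ 0.630`, `β⁰₂ ≈ 0.308` against `(11/(3π²))·log 2 ≈ 0.2575`, i.e. a `k = 0` deviation ≈ 0.37
but a `k = 1` deviation ≈ 0.05 = 0.20·θ at `θ = 1/4`), so the best ∀k constant `c₀` of §1 is set by `k = 0` — a depth
the certified lane covers anyway.  With the eventual shape the budget `c₀θ^{k₁}(1 + θ) < m` of §7 is read with the TAIL
constant: the certified lane certifies the depths `k ≤ k₁` (memo §4‴, protocol v3: `k₁ = 1`), the asymptotic lane owes
the rate for `k ≥ k₁` ONLY.  THE ALGEBRA: an eventual rate from `k₁` IS a §1 rate for the SHIFTED sequence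
`j ↦ b_{j+k₁}` with constant `c₀θ^{k₁}` (`EvGeomRate.shift`, `EvCauchyRate.shift`), so §1/§2/§7 apply verbatim at depth
`0` of the shifted sequence: `EvCauchyRate.evGeomRate` (constructed limit, constant `c/(1−θ)`, same threshold),
`EvGeomRate.lower_of_list` (the SAME margin `m − c₀θ^{k₁}(1 + θ)` as §7), `eventualFormOfFloor` (the §7 construction
from an abstract uniform floor `0 < b₀ ≤ β⁰_{k+1}`), END statements `thm2Printed_of_floor` / `thm2Printed_of_evMargin` /
`_of_evCauchyMargin` / `_of_evSymbolMargin`, `beta0_pos_all_of_evMargin` / `_of_evCauchyMargin`, `betaAFH_of_evMargin`,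
`endpointExistence_of_evMargin`.  `Witness.evMargin_gain`: a sequence with a first-step anomaly for which EVERY ∀k
rate fails the `k₁ = 1` gap while the eventual rate with the tail constant passes it.  Hypothesis shapes only; nothing
of the series is discharged; no number above enters any statement. -/

section EventualRate

/-- HYPOTHESIS SHAPE (AF-0r from a threshold scale): `|b_k − b_∞| ≤ c₀·θ^k` for all `k ≥ k₁` — the rate OWED by the
asymptotic lane when the certified lane covers the depths `k ≤ k₁`.  Located, NOT printed, for the coefficients (1.22).
[cite: Balaban1987RG1, (1.22) p.264] -/
def EvGeomRate (b : ℕ → ℝ) (binf c₀ θ : ℝ) (k₁ : ℕ) : Prop :=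
  ∀ k, k₁ ≤ k → |b k - binf| ≤ c₀ * θ ^ k

/-- HYPOTHESIS SHAPE (AF-0r, Cauchy form, from a threshold scale): `|b_{k+1} − b_k| ≤ c·θ^k` for all `k ≥ k₁`.
Located, NOT printed, for (1.22). [cite: Balaban1987RG1, (1.22) p.264] -/
def EvCauchyRate (b : ℕ → ℝ) (c θ : ℝ) (k₁ : ℕ) : Prop :=
  ∀ k, k₁ ≤ k → |b (k + 1) - b k| ≤ c * θ ^ k

/-- A rate (§1) is an eventual rate from every threshold. [folklore] -/
theorem GeomRate.evGeomRate {b : ℕ → ℝ} {binf c₀ θ : ℝ} (h : GeomRate b binf c₀ θ) (k₁ : ℕ) :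
    EvGeomRate b binf c₀ θ k₁ := fun k _ => h k

/-- A Cauchy rate (§1) is an eventual Cauchy rate from every threshold. [folklore] -/
theorem CauchyRate.evCauchyRate {b : ℕ → ℝ} {c θ : ℝ} (h : CauchyRate b c θ) (k₁ : ℕ) :
    EvCauchyRate b c θ k₁ := fun k _ => h k

/-- Threshold `0` is the ∀k shape of §1. [folklore] -/
theorem evGeomRate_zero_iff {b : ℕ → ℝ} {binf c₀ θ : ℝ} : EvGeomRate b binf c₀ θ 0 ↔ GeomRate b binf c₀ θ :=
  ⟨fun h k => h k (Nat.zero_le k), fun h => h.evGeomRate 0⟩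

/-- Threshold `0` is the ∀k Cauchy shape of §1. [folklore] -/
theorem evCauchyRate_zero_iff {b : ℕ → ℝ} {c θ : ℝ} : EvCauchyRate b c θ 0 ↔ CauchyRate b c θ :=
  ⟨fun h k => h k (Nat.zero_le k), fun h => h.evCauchyRate 0⟩

namespace EvGeomRate

variable {b : ℕ → ℝ} {binf c₀ θ : ℝ} {k₁ : ℕ}

/-- Raising the threshold. [folklore] -/
theorem of_le (h : EvGeomRate b binf c₀ θ k₁) {k₂ : ℕ} (hk : k₁ ≤ k₂) : EvGeomRate b binf c₀ θ k₂ :=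
  fun k hk' => h k (hk.trans hk')

/-- **An eventual rate from `k₁` IS a rate (§1) for the shifted sequence `j ↦ b_{j+k₁}`, constant `c₀θ^{k₁}`.**
[folklore] -/
theorem shift (h : EvGeomRate b binf c₀ θ k₁) : GeomRate (fun j => b (j + k₁)) binf (c₀ * θ ^ k₁) θ := fun j => by
  show |b (j + k₁) - binf| ≤ c₀ * θ ^ k₁ * θ ^ j
  calc |b (j + k₁) - binf| ≤ c₀ * θ ^ (j + k₁) := h (j + k₁) (Nat.le_add_left k₁ j)
    _ = c₀ * θ ^ k₁ * θ ^ j := by rw [pow_add]; ring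

/-- The slack at the threshold is `≥ 0`: `0 ≤ c₀θ^{k₁}` (take `k = k₁`). [folklore] -/
theorem slack_nonneg (h : EvGeomRate b binf c₀ θ k₁) : 0 ≤ c₀ * θ ^ k₁ :=
  h.shift.const_nonneg

/-- An eventual rate with `0 ≤ θ < 1` gives convergence `b_k → b_∞`. [folklore] -/
theorem tendsto (h : EvGeomRate b binf c₀ θ k₁) (hθ0 : 0 ≤ θ) (hθ1 : θ < 1) : Tendsto b atTop (𝓝 binf) :=
  (tendsto_add_atTop_iff_nat k₁).mp (h.shift.tendsto hθ0 hθ1)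

/-- Lower enclosure of the limit from one certified lower value at a depth `k ≥ k₁`: `m ≤ b_k` ⇒ `m − c₀θ^k ≤ b_∞`.
[folklore] -/
theorem binf_ge (h : EvGeomRate b binf c₀ θ k₁) {k : ℕ} (hk : k₁ ≤ k) {m : ℝ} (hm : m ≤ b k) :
    m - c₀ * θ ^ k ≤ binf := by
  have := (abs_le.mp (h k hk)).2
  linarith

/-- Upper enclosure of the limit from one certified upper value at a depth `k ≥ k₁`. [folklore] -/
theorem binf_le (h : EvGeomRate b binf c₀ θ k₁) {k : ℕ} (hk : k₁ ≤ k) {M : ℝ} (hM : b k ≤ M) :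
    binf ≤ M + c₀ * θ ^ k := by
  have := (abs_le.mp (h k hk)).1
  linarith

/-- **The uniform lower bound from the EVENTUAL rate + the one-sided certified list up to the threshold — the SAME
margin as §7**: `m ≤ b_k` for `k ≤ k₁` ⇒ `m − c₀θ^{k₁}(1 + θ) ≤ b_k` for EVERY `k` (`GeomRate.lower_of_list` at depth
`0` of the shifted sequence; below the threshold the list itself). [folklore] -/
theorem lower_of_list (h : EvGeomRate b binf c₀ θ k₁) (hθ0 : 0 ≤ θ) (hθ1 : θ ≤ 1) {m : ℝ}
    (hlist : ∀ k, k ≤ k₁ → m ≤ b k) : ∀ k, m - c₀ * θ ^ k₁ * (1 + θ) ≤ b k := fun k => by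
  rcases le_or_gt k k₁ with hk | hk
  · have h0 : 0 ≤ c₀ * θ ^ k₁ * (1 + θ) := mul_nonneg h.slack_nonneg (by linarith)
    linarith [hlist k hk]
  · obtain ⟨j, rfl⟩ := Nat.exists_eq_add_of_le' hk.le
    have hl0 : ∀ i, i ≤ 0 → m ≤ (fun j => b (j + k₁)) i := fun i hi => by
      obtain rfl := Nat.le_zero.mp hi
      simpa using hlist k₁ le_rfl
    have := h.shift.lower_of_list hθ0 hθ1 hl0 j
    simpa using this

/-- **Positivity of EVERY term from the eventual rate, the one-sided list and the gap `c₀θ^{k₁}(1 + θ) < m`** (the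
coordinator's «betaBar_pos_of_ge k₀» with positivity below `k₀` from the certified values). [folklore] -/
theorem pos_all_of_list (h : EvGeomRate b binf c₀ θ k₁) (hθ0 : 0 ≤ θ) (hθ1 : θ ≤ 1) {m : ℝ}
    (hlist : ∀ k, k ≤ k₁ → m ≤ b k) (hgap : c₀ * θ ^ k₁ * (1 + θ) < m) : ∀ k, 0 < b k := fun k => by
  have := h.lower_of_list hθ0 hθ1 hlist k
  linarith

/-- Under the gap the (never identified) limit is positive: `b_∞ ≥ m − c₀θ^{k₁} > c₀θ^{k₁}θ ≥ 0`. [folklore] -/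
theorem binf_pos_of_gap (h : EvGeomRate b binf c₀ θ k₁) (hθ0 : 0 ≤ θ) {m : ℝ} (hm : m ≤ b k₁)
    (hgap : c₀ * θ ^ k₁ * (1 + θ) < m) : 0 < binf := by
  have h1 := h.binf_ge le_rfl hm
  have : 0 ≤ c₀ * θ ^ k₁ * θ := mul_nonneg h.slack_nonneg hθ0
  nlinarith

end EvGeomRate

namespace EvCauchyRate

variable {b : ℕ → ℝ} {c θ : ℝ} {k₁ : ℕ}

/-- Raising the threshold. [folklore] -/
theorem of_le (h : EvCauchyRate b c θ k₁) {k₂ : ℕ} (hk : k₁ ≤ k₂) : EvCauchyRate b c θ k₂ :=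
  fun k hk' => h k (hk.trans hk')

/-- **An eventual Cauchy rate from `k₁` IS a Cauchy rate (§1) for the shifted sequence `j ↦ b_{j+k₁}`, constant
`cθ^{k₁}`.** [folklore] -/
theorem shift (h : EvCauchyRate b c θ k₁) : CauchyRate (fun j => b (j + k₁)) (c * θ ^ k₁) θ := fun j => by
  show |b (j + 1 + k₁) - b (j + k₁)| ≤ c * θ ^ k₁ * θ ^ j
  have e : j + 1 + k₁ = j + k₁ + 1 := by omega
  calc |b (j + 1 + k₁) - b (j + k₁)| = |b (j + k₁ + 1) - b (j + k₁)| := by rw [e]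
    _ ≤ c * θ ^ (j + k₁) := h (j + k₁) (Nat.le_add_left k₁ j)
    _ = c * θ ^ k₁ * θ ^ j := by rw [pow_add]; ring

/-- `0 ≤ cθ^{k₁}`. [folklore] -/
theorem slack_nonneg (h : EvCauchyRate b c θ k₁) : 0 ≤ c * θ ^ k₁ :=
  h.shift.const_nonneg

/-- Under an eventual Cauchy rate with `θ < 1`, `b_k →` the constructed limit `CauchyRate.lim b` of §1. [folklore] -/
theorem tendsto_lim (h : EvCauchyRate b c θ k₁) (hθ1 : θ < 1) : Tendsto b atTop (𝓝 (CauchyRate.lim b)) :=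
  tendsto_nhds_limUnder ⟨_, (tendsto_add_atTop_iff_nat k₁).mp (h.shift.tendsto_lim hθ1)⟩

/-- The shifted sequence has the same constructed limit. [folklore] -/
theorem lim_shift (h : EvCauchyRate b c θ k₁) (hθ1 : θ < 1) :
    CauchyRate.lim (fun j => b (j + k₁)) = CauchyRate.lim b :=
  tendsto_nhds_unique ((tendsto_add_atTop_iff_nat k₁).mp (h.shift.tendsto_lim hθ1)) (h.tendsto_lim hθ1)

/-- **Eventual Cauchy rate ⇒ eventual two-ended rate about the constructed limit, constant `c/(1−θ)`, SAME
threshold** (`CauchyRate.geomRate` for the shifted sequence). [folklore] -/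
theorem evGeomRate (h : EvCauchyRate b c θ k₁) (hθ1 : θ < 1) :
    EvGeomRate b (CauchyRate.lim b) (c / (1 - θ)) θ k₁ := fun k hk => by
  obtain ⟨j, rfl⟩ := Nat.exists_eq_add_of_le' hk
  have h1 := h.shift.geomRate hθ1 j
  rw [h.lim_shift hθ1] at h1
  calc |b (j + k₁) - CauchyRate.lim b| ≤ c * θ ^ k₁ / (1 - θ) * θ ^ j := h1
    _ = c / (1 - θ) * θ ^ (j + k₁) := by rw [pow_add]; ring

/-- … about ANY known limit value `a` of `b`. [folklore] -/
theorem evGeomRate_of_tendsto (h : EvCauchyRate b c θ k₁) (hθ1 : θ < 1) {a : ℝ} (ha : Tendsto b atTop (𝓝 a)) :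
    EvGeomRate b a (c / (1 - θ)) θ k₁ := by
  rw [tendsto_nhds_unique ha (h.tendsto_lim hθ1)]; exact h.evGeomRate hθ1

end EvCauchyRate

variable {d : ℕ} {β : HBeta}

/-- **(CONV-Π̂ from a threshold scale) the EVENTUAL symbol step rate** (OPEN for Bałaban's kernels; hypothesis shape
only): the §6 statement `SymbolStepRate` for the scales `k ≥ k₁` only — the momentum-space form in which the
asymptotic lane's suppliers are asked to deliver the tail (memo R-asym1-2, R-asym1-4). [cite: Balaban1987RG1, (1.22) p.264] -/
def EvSymbolStepRate (P : ℕ → B12Beta.Kernel d) (μ ν : Fin d) (c θ : ℝ) (k₁ : ℕ) : Prop :=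
  ∀ k, k₁ ≤ k → ∀ v ∈ ({Pi.single μ 1, Pi.single ν 1, Pi.single μ 1 + Pi.single ν 1} : Set (Fin d → ℤ)),
    |MomentSymbol.dirSymbolD2 (P (k + 1) μ ν) v 0 - MomentSymbol.dirSymbolD2 (P k μ ν) v 0| ≤ c * θ ^ k

/-- The §6 shape is the eventual one from every threshold. [folklore] -/
theorem SymbolStepRate.evSymbolStepRate {P : ℕ → B12Beta.Kernel d} {μ ν : Fin d} {c θ : ℝ}
    (h : SymbolStepRate P μ ν c θ) (k₁ : ℕ) : EvSymbolStepRate P μ ν c θ k₁ := fun k _ => h k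

/-- An eventual symbol step rate is an eventual Cauchy rate with constant `(3/2)·c`, same threshold, for any scalar
sequence identified with the second moments (1.22) (`MomentSymbol.abs_secondMoment_sub_le`, scale by scale).
[cite: Balaban1987RG1, (1.22) p.264] -/
theorem EvSymbolStepRate.evCauchyRate {P : ℕ → B12Beta.Kernel d} {μ ν : Fin d} {c θ : ℝ} {k₁ : ℕ}
    (h : EvSymbolStepRate P μ ν c θ k₁) (hP : ∀ k, PolarizationSign.MomentSummable (P k) 2) {b : ℕ → ℝ}
    (hb : ∀ k, b k = B12Beta.secondMoment (P k) μ ν) : EvCauchyRate b (3 / 2 * c) θ k₁ := by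
  intro k hk
  rw [hb, hb]
  have := MomentSymbol.abs_secondMoment_sub_le (hP (k + 1)) (hP k) μ ν (h k hk)
  linarith

/-- **`EventualForm` FROM A UNIFORM FLOOR — the §7 construction with the floor abstracted.**  Data: the printed split
`S`; a box size `γ₀`; a floor `0 < b₀ ≤ β⁰_{k+1}` for ALL `k` (supplied below by `EvGeomRate.lower_of_list`, in §7 by
`GeomRate.lower_of_list`, or by anything else); (AF-1) with constant `C_r`, (C) and (U) on `]0,γ₀]`-boxes.  Output: the
minimal form of `Beta.Assembly` with `b := b₀/2`, `k₀ := 0`, box `]0, marginBox γ₀ C_r b₀]`, by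
`Assembly.EventualForm.ofSplitOneSided` exactly as in `eventualFormOfMargin`. [cite: Balaban1987RG1, (2.12)–(2.14) p.268 and §1 p.264] -/
noncomputable def eventualFormOfFloor (S : B12Beta.OneLoopSplit β) {γ₀ b₀ Cr β' : ℝ} (hγ₀ : 0 < γ₀) (hb₀ : 0 < b₀)
    (hfloor : ∀ k, b₀ ≤ S.β0 k) (hCr : 0 ≤ Cr)
    (haf1 : ∀ k (p : Fin (k + 1) → ℝ), p ∈ B12Beta.HistBox γ₀ k → |S.β1 k p| ≤ Cr * p (Fin.last k))
    (hcont : BetaContH γ₀ β) (hup : BetaUpperH β' γ₀ β) : Assembly.EventualForm β :=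
  Assembly.EventualForm.ofSplitOneSided S (γ₀ := marginBox γ₀ Cr b₀) (b := b₀ / 2) (β' := β') (k₀ := 0)
    (marginBox_pos hγ₀ hCr hb₀) (half_pos hb₀)
    (fun k _ => by have := hfloor k; linarith)
    (fun k _ v hv => by
      have hvγ : v (Fin.last k) ≤ marginBox γ₀ Cr b₀ := (mem_box.mp hv (Fin.last k)).2
      have h1 := haf1 k v (histBox_of_mem_box (Assembly.LimitForm.box_mono (marginBox_le _ _ _) hv))
      have h2 : Cr * v (Fin.last k) ≤ Cr * marginBox γ₀ Cr b₀ := mul_le_mul_of_nonneg_left hvγ hCr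
      have h3 := Cr_mul_marginBox_le (γ₀ := γ₀) hCr hb₀
      have h4 := (abs_le.mp (h1.trans (h2.trans h3))).1
      linarith)
    (fun k v hv => hup k v (Assembly.LimitForm.box_mono (marginBox_le _ _ _) hv))
    (fun k v hv => by
      have hvγ : v (Fin.last k) ≤ marginBox γ₀ Cr b₀ := (mem_box.mp hv (Fin.last k)).2
      have h0 := hfloor k
      have h1 := haf1 k v (histBox_of_mem_box (Assembly.LimitForm.box_mono (marginBox_le _ _ _) hv))
      have h2 : Cr * v (Fin.last k) ≤ Cr * marginBox γ₀ Cr b₀ := mul_le_mul_of_nonneg_left hvγ hCr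
      have h3 := Cr_mul_marginBox_le (γ₀ := γ₀) hCr hb₀
      have h4 := (abs_le.mp (h1.trans (h2.trans h3))).1
      have h5 := hup k v (Assembly.LimitForm.box_mono (marginBox_le _ _ _) hv)
      have h6 := S.split k v
      linarith)
    (fun k => (hcont k).mono fun _ hv => Assembly.LimitForm.box_mono (marginBox_le _ _ _) hv)

/-- Its constants: `b = b₀/2`, `k₀ = 0`, box `marginBox γ₀ C_r b₀`. [folklore] -/
theorem eventualFormOfFloor_consts (S : B12Beta.OneLoopSplit β) {γ₀ b₀ Cr β' : ℝ} (hγ₀ : 0 < γ₀) (hb₀ : 0 < b₀)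
    (hfloor : ∀ k, b₀ ≤ S.β0 k) (hCr : 0 ≤ Cr)
    (haf1 : ∀ k (p : Fin (k + 1) → ℝ), p ∈ B12Beta.HistBox γ₀ k → |S.β1 k p| ≤ Cr * p (Fin.last k))
    (hcont : BetaContH γ₀ β) (hup : BetaUpperH β' γ₀ β) :
    (eventualFormOfFloor S hγ₀ hb₀ hfloor hCr haf1 hcont hup).b = b₀ / 2 ∧
      (eventualFormOfFloor S hγ₀ hb₀ hfloor hCr haf1 hcont hup).k₀ = 0 ∧
      (eventualFormOfFloor S hγ₀ hb₀ hfloor hCr haf1 hcont hup).γ₀ = marginBox γ₀ Cr b₀ :=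
  ⟨rfl, rfl, rfl⟩

/-- **THEOREM 2 AS PRINTED FROM A UNIFORM FLOOR** (linear remainder form (AF-1)): the DAG, `1 < L`, the split, a floor
`0 < b₀ ≤ β⁰_{k+1}` (all `k`), (AF-1) with `C_r ≥ 0`, (C), (U) ⟹ `B12.Thm2Printed C L`
(`Assembly.EventualForm.thm2Printed_of_list` on `eventualFormOfFloor`, EMPTY list).  The twin of asym2's
`RemainderConstCertified.thm2Printed_of_floor_const` (constant remainder form). [cite: Balaban1987RG1, Thm 2 p.259 with (0.31)] -/
theorem thm2Printed_of_floor {C : B12.Construction} (hgen : ForwardGenerated C β) {L : ℝ} (hL : 1 < L)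
    (S : B12Beta.OneLoopSplit β) {γ₀ b₀ Cr β' : ℝ} (hγ₀ : 0 < γ₀) (hb₀ : 0 < b₀) (hfloor : ∀ k, b₀ ≤ S.β0 k)
    (hCr : 0 ≤ Cr)
    (haf1 : ∀ k (p : Fin (k + 1) → ℝ), p ∈ B12Beta.HistBox γ₀ k → |S.β1 k p| ≤ Cr * p (Fin.last k))
    (hcont : BetaContH γ₀ β) (hup : BetaUpperH β' γ₀ β) : B12.Thm2Printed C L :=
  (eventualFormOfFloor S hγ₀ hb₀ hfloor hCr haf1 hcont hup).thm2Printed_of_list hgen hL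
    fun k hk => absurd hk (Nat.not_lt_zero k)

/-- **Discrete asymptotic freedom `BetaAFH β` from a uniform floor** (witness box `marginBox γ₀ C_r b₀`, constant
`b₀/2`). [folklore] -/
theorem betaAFH_of_floor (S : B12Beta.OneLoopSplit β) {γ₀ b₀ Cr β' : ℝ} (hγ₀ : 0 < γ₀) (hb₀ : 0 < b₀)
    (hfloor : ∀ k, b₀ ≤ S.β0 k) (hCr : 0 ≤ Cr)
    (haf1 : ∀ k (p : Fin (k + 1) → ℝ), p ∈ B12Beta.HistBox γ₀ k → |S.β1 k p| ≤ Cr * p (Fin.last k))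
    (hcont : BetaContH γ₀ β) (hup : BetaUpperH β' γ₀ β) : BetaAFH β := by
  set E := eventualFormOfFloor S hγ₀ hb₀ hfloor hCr haf1 hcont hup with hE
  exact ⟨E.γ₀, E.γ₀_pos, E.b, E.b_pos, E.betaLowerH_of_list fun k hk => absurd hk (Nat.not_lt_zero k)⟩

/-- **Endpoint existence (Theorem 2, first sentence) from a uniform floor.** [cite: Balaban1987RG1, Thm 2 p.259 (first sentence)] -/
theorem endpointExistence_of_floor (S : B12Beta.OneLoopSplit β) {γ₀ b₀ Cr β' : ℝ} (hγ₀ : 0 < γ₀) (hb₀ : 0 < b₀)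
    (hfloor : ∀ k, b₀ ≤ S.β0 k) (hCr : 0 ≤ Cr)
    (haf1 : ∀ k (p : Fin (k + 1) → ℝ), p ∈ B12Beta.HistBox γ₀ k → |S.β1 k p| ≤ Cr * p (Fin.last k))
    (hcont : BetaContH γ₀ β) (hup : BetaUpperH β' γ₀ β) {C : B12.Construction} (hgen : ForwardGenerated C β) :
    EndpointExistence C :=
  (eventualFormOfFloor S hγ₀ hb₀ hfloor hCr haf1 hcont hup).endpointExistence hgen

/-- **THEOREM 2 AS PRINTED — THE MARGIN FORM WITH AN EVENTUAL RATE (first-step exemption).**  Inputs: the DAG,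
`1 < L`; the split `S`; (asym) an EVENTUAL rate `EvGeomRate S.β0 binf c₀ θ k₁` from the threshold `k₁` on, `0 ≤ θ ≤ 1`,
`binf` ANY real; (cap) one-sided certified lower values `m ≤ β⁰_{k+1}` for EVERY depth `k ≤ k₁` and the gap
`c₀θ^{k₁}(1 + θ) < m` — the SAME inequality as `thm2Printed_of_margin`, now with `c₀` the TAIL constant; (an4) (AF-1),
(C); (printed) (U).  `thm2Printed_of_floor` ∘ `EvGeomRate.lower_of_list`. [cite: Balaban1987RG1, Thm 2 p.259 with (0.31)] -/
theorem thm2Printed_of_evMargin {C : B12.Construction} (hgen : ForwardGenerated C β) {L : ℝ} (hL : 1 < L)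
    (S : B12Beta.OneLoopSplit β) {γ₀ binf c₀ θ Cr β' m : ℝ} {k₁ : ℕ} (hγ₀ : 0 < γ₀) (hθ0 : 0 ≤ θ) (hθ1 : θ ≤ 1)
    (hconv : EvGeomRate S.β0 binf c₀ θ k₁) (hlist : ∀ k, k ≤ k₁ → m ≤ S.β0 k) (hgap : c₀ * θ ^ k₁ * (1 + θ) < m)
    (hCr : 0 ≤ Cr)
    (haf1 : ∀ k (p : Fin (k + 1) → ℝ), p ∈ B12Beta.HistBox γ₀ k → |S.β1 k p| ≤ Cr * p (Fin.last k))
    (hcont : BetaContH γ₀ β) (hup : BetaUpperH β' γ₀ β) : B12.Thm2Printed C L :=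
  thm2Printed_of_floor hgen hL S hγ₀ (margin_pos hgap) (hconv.lower_of_list hθ0 hθ1 hlist) hCr haf1 hcont hup

/-- **The eventual margin form from the EVENTUAL CAUCHY shape** (`c₀ = c/(1−θ)`, `θ < 1`; the constructed limit never
appears; the rate is owed for `k ≥ k₁` only). [cite: Balaban1987RG1, Thm 2 p.259 with (0.31)] -/
theorem thm2Printed_of_evCauchyMargin {C : B12.Construction} (hgen : ForwardGenerated C β) {L : ℝ} (hL : 1 < L)
    (S : B12Beta.OneLoopSplit β) {γ₀ c θ Cr β' m : ℝ} {k₁ : ℕ} (hγ₀ : 0 < γ₀) (hθ0 : 0 ≤ θ) (hθ1 : θ < 1)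
    (hrate : EvCauchyRate S.β0 c θ k₁) (hlist : ∀ k, k ≤ k₁ → m ≤ S.β0 k)
    (hgap : c / (1 - θ) * θ ^ k₁ * (1 + θ) < m) (hCr : 0 ≤ Cr)
    (haf1 : ∀ k (p : Fin (k + 1) → ℝ), p ∈ B12Beta.HistBox γ₀ k → |S.β1 k p| ≤ Cr * p (Fin.last k))
    (hcont : BetaContH γ₀ β) (hup : BetaUpperH β' γ₀ β) : B12.Thm2Printed C L :=
  thm2Printed_of_evMargin hgen hL S hγ₀ hθ0 hθ1.le (hrate.evGeomRate hθ1) hlist hgap hCr haf1 hcont hup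

/-- **The eventual margin form through the EVENTUAL SYMBOL SOCKET** (`c₀ = (3/2)c/(1−θ)`; the three zero-momentum
curvatures per scale, for the scales `k ≥ k₁` only; identification `S.β0 k = secondMoment (P k) μ ν` ((1.22) at zero
couplings)). [cite: Balaban1987RG1, (1.22) p.264 and Thm 2 p.259 with (0.31)] -/
theorem thm2Printed_of_evSymbolMargin {C : B12.Construction} (hgen : ForwardGenerated C β) {L : ℝ} (hL : 1 < L)
    (S : B12Beta.OneLoopSplit β) {P : ℕ → B12Beta.Kernel d} {μ ν : Fin d}
    (hP : ∀ k, PolarizationSign.MomentSummable (P k) 2) (hβ0 : ∀ k, S.β0 k = B12Beta.secondMoment (P k) μ ν)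
    {γ₀ c θ Cr β' m : ℝ} {k₁ : ℕ} (hγ₀ : 0 < γ₀) (hθ0 : 0 ≤ θ) (hθ1 : θ < 1) (hrate : EvSymbolStepRate P μ ν c θ k₁)
    (hlist : ∀ k, k ≤ k₁ → m ≤ S.β0 k) (hgap : 3 / 2 * c / (1 - θ) * θ ^ k₁ * (1 + θ) < m) (hCr : 0 ≤ Cr)
    (haf1 : ∀ k (p : Fin (k + 1) → ℝ), p ∈ B12Beta.HistBox γ₀ k → |S.β1 k p| ≤ Cr * p (Fin.last k))
    (hcont : BetaContH γ₀ β) (hup : BetaUpperH β' γ₀ β) : B12.Thm2Printed C L :=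
  thm2Printed_of_evCauchyMargin hgen hL S hγ₀ hθ0 hθ1 (hrate.evCauchyRate hP hβ0) hlist hgap hCr haf1 hcont hup

/-- **Positivity of EVERY one-loop coefficient** from the eventual rate, the one-sided list up to the threshold and the
gap alone (no (AF-1)/(C)/(U), no DAG) — «betaBar_pos_of_ge k₀» + the certified depths. [folklore] -/
theorem beta0_pos_all_of_evMargin (S : B12Beta.OneLoopSplit β) {binf c₀ θ m : ℝ} {k₁ : ℕ} (hθ0 : 0 ≤ θ)
    (hθ1 : θ ≤ 1) (hconv : EvGeomRate S.β0 binf c₀ θ k₁) (hlist : ∀ k, k ≤ k₁ → m ≤ S.β0 k)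
    (hgap : c₀ * θ ^ k₁ * (1 + θ) < m) : ∀ k, 0 < S.β0 k :=
  hconv.pos_all_of_list hθ0 hθ1 hlist hgap

/-- … with the explicit uniform lower bound `m − c₀θ^{k₁}(1 + θ) ≤ β⁰_{k+1}` for all `k`. [folklore] -/
theorem beta0_lower_all_of_evMargin (S : B12Beta.OneLoopSplit β) {binf c₀ θ m : ℝ} {k₁ : ℕ} (hθ0 : 0 ≤ θ)
    (hθ1 : θ ≤ 1) (hconv : EvGeomRate S.β0 binf c₀ θ k₁) (hlist : ∀ k, k ≤ k₁ → m ≤ S.β0 k) :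
    ∀ k, m - c₀ * θ ^ k₁ * (1 + θ) ≤ S.β0 k :=
  hconv.lower_of_list hθ0 hθ1 hlist

/-- Positivity of every one-loop coefficient from the EVENTUAL CAUCHY shape (`c₀ = c/(1−θ)`). [folklore] -/
theorem beta0_pos_all_of_evCauchyMargin (S : B12Beta.OneLoopSplit β) {c θ m : ℝ} {k₁ : ℕ} (hθ0 : 0 ≤ θ)
    (hθ1 : θ < 1) (hrate : EvCauchyRate S.β0 c θ k₁) (hlist : ∀ k, k ≤ k₁ → m ≤ S.β0 k)
    (hgap : c / (1 - θ) * θ ^ k₁ * (1 + θ) < m) : ∀ k, 0 < S.β0 k :=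
  (hrate.evGeomRate hθ1).pos_all_of_list hθ0 hθ1.le hlist hgap

/-- **Discrete asymptotic freedom `BetaAFH β` from the eventual margin form.** [folklore] -/
theorem betaAFH_of_evMargin (S : B12Beta.OneLoopSplit β) {γ₀ binf c₀ θ Cr β' m : ℝ} {k₁ : ℕ} (hγ₀ : 0 < γ₀)
    (hθ0 : 0 ≤ θ) (hθ1 : θ ≤ 1) (hconv : EvGeomRate S.β0 binf c₀ θ k₁) (hlist : ∀ k, k ≤ k₁ → m ≤ S.β0 k)
    (hgap : c₀ * θ ^ k₁ * (1 + θ) < m) (hCr : 0 ≤ Cr)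
    (haf1 : ∀ k (p : Fin (k + 1) → ℝ), p ∈ B12Beta.HistBox γ₀ k → |S.β1 k p| ≤ Cr * p (Fin.last k))
    (hcont : BetaContH γ₀ β) (hup : BetaUpperH β' γ₀ β) : BetaAFH β :=
  betaAFH_of_floor S hγ₀ (margin_pos hgap) (hconv.lower_of_list hθ0 hθ1 hlist) hCr haf1 hcont hup

/-- **Endpoint existence from the eventual margin form.** [cite: Balaban1987RG1, Thm 2 p.259 (first sentence)] -/
theorem endpointExistence_of_evMargin (S : B12Beta.OneLoopSplit β) {γ₀ binf c₀ θ Cr β' m : ℝ} {k₁ : ℕ}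
    (hγ₀ : 0 < γ₀) (hθ0 : 0 ≤ θ) (hθ1 : θ ≤ 1) (hconv : EvGeomRate S.β0 binf c₀ θ k₁)
    (hlist : ∀ k, k ≤ k₁ → m ≤ S.β0 k) (hgap : c₀ * θ ^ k₁ * (1 + θ) < m) (hCr : 0 ≤ Cr)
    (haf1 : ∀ k (p : Fin (k + 1) → ℝ), p ∈ B12Beta.HistBox γ₀ k → |S.β1 k p| ≤ Cr * p (Fin.last k))
    (hcont : BetaContH γ₀ β) (hup : BetaUpperH β' γ₀ β) {C : B12.Construction} (hgen : ForwardGenerated C β) :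
    EndpointExistence C :=
  endpointExistence_of_floor S hγ₀ (margin_pos hgap) (hconv.lower_of_list hθ0 hθ1 hlist) hCr haf1 hcont hup hgen

/-- The §7 margin form is the case «threshold anywhere, ∀k rate»: a `GeomRate` feeds `thm2Printed_of_evMargin` at every
`k₁` (so §12 subsumes §7's END statement; §7 is kept as is). [folklore] -/
theorem thm2Printed_of_margin' {C : B12.Construction} (hgen : ForwardGenerated C β) {L : ℝ} (hL : 1 < L)
    (S : B12Beta.OneLoopSplit β) {γ₀ binf c₀ θ Cr β' m : ℝ} {k₁ : ℕ} (hγ₀ : 0 < γ₀) (hθ0 : 0 ≤ θ) (hθ1 : θ ≤ 1)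
    (hconv : GeomRate S.β0 binf c₀ θ) (hlist : ∀ k, k ≤ k₁ → m ≤ S.β0 k) (hgap : c₀ * θ ^ k₁ * (1 + θ) < m)
    (hCr : 0 ≤ Cr)
    (haf1 : ∀ k (p : Fin (k + 1) → ℝ), p ∈ B12Beta.HistBox γ₀ k → |S.β1 k p| ≤ Cr * p (Fin.last k))
    (hcont : BetaContH γ₀ β) (hup : BetaUpperH β' γ₀ β) : B12.Thm2Printed C L :=
  thm2Printed_of_evMargin hgen hL S hγ₀ hθ0 hθ1 (hconv.evGeomRate k₁) hlist hgap hCr haf1 hcont hup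

namespace Witness

/-- A sequence with a FIRST-STEP ANOMALY: `b_0 = 3`, `b_k = 1 + (1/2)^k` for `k ≥ 1` (`b_∞ = 1`, `θ = 1/2`).
[folklore] -/
noncomputable def bAnom (k : ℕ) : ℝ := if k = 0 then 3 else 1 + (1 / 2 : ℝ) ^ k

/-- **The gain of the eventual shape, witnessed**: the eventual rate `EvGeomRate bAnom 1 1 (1/2) 1` (tail constant `1`)
with the one-sided list `1 ≤ b_k (k ≤ 1)` PASSES the `k₁ = 1` gap (`1·(1/2)·(3/2) = 3/4 < 1`), while EVERY ∀k rate
`GeomRate bAnom 1 c₀ (1/2)` has `c₀ ≥ |b_0 − 1| = 2` and FAILS it (`c₀·(1/2)·(3/2) ≥ 3/2`). [folklore] -/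
theorem evMargin_gain :
    EvGeomRate bAnom 1 1 (1 / 2) 1 ∧ (∀ k, k ≤ 1 → (1 : ℝ) ≤ bAnom k) ∧ (1 : ℝ) * (1 / 2) ^ 1 * (1 + 1 / 2) < 1 ∧
      ∀ c₀ : ℝ, GeomRate bAnom 1 c₀ (1 / 2) → ¬ c₀ * (1 / 2) ^ 1 * (1 + 1 / 2) < 1 := by
  refine ⟨?_, ?_, by norm_num, ?_⟩
  · intro k hk
    have hk0 : k ≠ 0 := by omega
    simp only [bAnom, if_neg hk0, add_sub_cancel_left, one_mul]
    exact le_of_eq (abs_of_nonneg (by positivity))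
  · intro k hk
    rcases Nat.le_one_iff_eq_zero_or_eq_one.mp hk with rfl | rfl
    · norm_num [bAnom]
    · norm_num [bAnom]
  · intro c₀ h hlt
    have h0 := h 0
    have hb : bAnom 0 = 3 := if_pos rfl
    rw [hb, show (3 : ℝ) - 1 = 2 by norm_num, abs_of_pos (by norm_num : (0 : ℝ) < 2), pow_zero, mul_one] at h0
    have e : c₀ * (1 / 2 : ℝ) ^ 1 * (1 + 1 / 2) = 3 / 4 * c₀ := by ring
    rw [e] at hlt
    linarith

/-- … so positivity of every term of `bAnom` follows from the EVENTUAL road (`EvGeomRate.pos_all_of_list`) — a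
conclusion the ∀k road of §7 cannot reach at `k₁ = 1` for this sequence with any admissible constant. [folklore] -/
theorem bAnom_pos_all : ∀ k, 0 < bAnom k :=
  evMargin_gain.1.pos_all_of_list (by norm_num) (by norm_num) evMargin_gain.2.1 evMargin_gain.2.2.1

end Witness

end EventualRate


end Literature.MathematicalPhysics.QuantumFieldTheory.Balaban1983to89.Beta.RateCertificate
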